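import Literature.MathematicalPhysics.QuantumFieldTheory.Balaban1983to89.B1Cor23RegularRegion
import Literature.MathematicalPhysics.QuantumFieldTheory.Balaban1983to89.B1Ineq229ZeroFieldRegion

/-!
# `Balaban1983to89.B1Ineq229RegularRegion` — T. Bałaban, *(Higgs)₂,₃ quantum fields in a finite volume. I. A lower bound*,
# Commun. Math. Phys. **85** (1982) 603–626 [Balaban1982Higgs1], PROPOSITION 2.2, SECOND CLAUSE (2.28)–(2.29) p. 611, **AT A REGULAR
# `A ≠ 0` FOR NESTED REGIONS `Ω = B^k(Λ_k) ⊆ Ω₀ = B^k(Λ⁰_k) ⊆ T_ε` ON THE CONCRETE (Higgs)₂,₃ CARRIER**, every level `1 ≤ k ≤ K`: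
# `|(Δ^{(k),L^kε}(Ω,A) − Δ^{(k),L^kε}(Ω₀,A))(p,q)| ≤ c₀(L^kε)⁻²e^{−δ₀(|x_p−x_q| + dist(x_p,Ω^{(k)c}) + dist(x_q,Ω^{(k)c}))}` with ONE `(δ₀, c₀)`
# — functions of `(d, L, a)` — for every `ε`, torus, `k`, `Λ_k ⊆ Λ⁰_k`, `m² > 0`, `N` AND EVERY `A` regular on `Ω₀` with
# `d²·ε|e|·L^{2k}·δ_A ≤ 1/3`; r14 g12's zero-field ENERGY COMPARISON ([Balaban1983RegularityDecay] (5.5) p. 594) replayed at a regular `A`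
# with r14 g14's Cor. 2.3 for regions at a regular `A` (`B1Cor23RegularRegion`) as the decay input

statement-level skeleton of published theorems with citation tags; proofs where landed; nothing here is a claim about the Yang–Mills mass gap

PDF held: `paper:balaban1982-cmp85-higgs23-i` (journal page = PDF page + 602), p. 611 [PDF 9] (2.27)–(2.29) (OCR `p0009.txt` l. 8–15, re-read
by this seat), p. 610 [PDF 8] (2.17), (2.20)–(2.23); [Balaban1983RegularityDecay] = `paper:balaban1983-cmp89-regularity-decay` p. 580
[PDF 10] Cor. 2.3, p. 594 [PDF 24] (5.5).

CITATION HEADER (lean-in-tree rule).  Cell `lit-balaban` (HOME `run/shared/lean/pub/lit-balaban/`), reader/typer seat **r14** gen 14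
(unit `lit-balaban-r14`, B1 fold owner; TAKING line HOME/STATUS.md 2026-08-22T07:18:39Z).  SKELETON row **B1.Prop2.2** (decl of record
`B1.prop22_kernelDecay`; (2.27) at a regular `A` for regions = r14 g14 `B1Prop23RegularRegion.ineq227_regular_region`; (2.28)–(2.29) at
`A = 0` for nested regions = r14 g12 `B1Ineq229ZeroFieldRegion`) — THIS file is the `A ≠ 0` MODEL INSTANCE of the second clause for nested
regions on the concrete carrier; it feeds (2.38) through r14 g9's `B1Ineq234ZeroFieldRegion.ineq238_region` (localisation input (5.5)).
USED BY NAME, never restated: r14 g12 `B1Ineq229ZeroFieldRegion.{two_mul_siteInner_sub_form_le, siteInner_propagatorK_eq_variational,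
siteInner_propagatorK_anti, abs_siteInner_propagatorK_sub_le, siteInner_propagatorK_sub_self_nonneg, siteInner_covOpK_eq_of_vanish,
siteInner_sub_le_form_cutoff, block_comm_le, sum_blockK_sum, blockUnion_of_iff, subset_of_iff, far_from_defect, mat_deltaKA_sub_eq}` (all
stated for a general external field `A`, or field-free), r14 g14 `B1Cor23RegularRegion.{siteInner_covOpK_eq, covDeriv_eq, propagatorK_supported,
propagatorK_pairing_regular_region, delta_admissible}`, `B1Ineq18RegularRegion.{coercive_covOpK_regular_region_uniform, gammaReg_pos}`, r14 g9
`B1Cor23ZeroFieldRegion.{exists_weight, tdist_le_of_blockIter_eq_real}`, r14 g7 `B1Ineq234Concrete.{avgQkAdj_cb_eq_zero, siteInner_avgQkAdj_cb,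
mul_tdist_blockIter_le, mat_QGQ_eq, distC, distC_le}`, `B2Restr216Lattice.norm_U_apply`, typer `B1Eq230FluctCov.{mat, cb, deltaKA, coeff221}`,
`HiggsCovariancePos.{covOpK_propagatorK_apply, siteInner_propagatorK_nonneg}`.

WHAT IS PRINTED (verbatim, [B1] p. 611 [PDF 9], OCR `p0009.txt` l. 8–15): *"Proposition 2.2. If a configuration A is regular in the
same sense as in Proposition 2.1 then there exist constants δ₀ > 0 and c₀, depending on the same quantities as in Proposition 2.1,
such that |Δ^{(k)}(Ω, A; x, x′)| ≦ c₀exp(−δ₀|x − x′|), x, x′ ∈ Ω^{(k)}_1 (2.27) Putting for Ω ⊂ Ω₀  δΔ^{(k)}(Ω, Ω₀, A) = Δ^{(k)}(Ω, A) −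
Δ^{(k)}(Ω₀, A), (2.28) the following inequality holds |δΔ^{(k)}(Ω, Ω₀, A; x, x′)| ≦ c₀exp(−δ₀(|x − x′| + dist(x, Ω^{(k)c}) +
dist(x′, Ω^{(k)c}))). (2.29)"*; [13] pp. 593–594 [PDF 23 l. 35–37, PDF 24 l. 2–4] (v1.1: quote corrected, ref-4 S-B1-g42-1; display (5.5) read on the render `pub-balaban/b2b-balaban-ref1/pages/1983-cmp89-regularity-decay/…-p024-x2.png` by ref-4 g42): *"Finally Corollary 2.3 implies that the
considered operator is short-ranged in the sense that for some δ₀ > 0 [(5.4)] and a change of the domain Ω implies a change of the operator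
which can be estimated in the following way |(Δ^{(k)}(Ω,A) − Δ^{(k)}(Ω₀,A))(x,x′)| ≦ c₀e^{−δ₀(|x−x′|+dist(x,Ω^{(k)c})+dist(x′,Ω^{(k)c}))}, Ω ⊂ Ω₀,
x,x′ ∈ Ω^{(k)}. (5.5) From these properties it follows that Proposition I.2.3 is a consequence of the following Theorem."*

DICTIONARY.  As in `B1Ineq229ZeroFieldRegion` (`Ω^{(k)} = Λ_k`, `Ω = B^k(Λ_k)` given through `hΩΛ : x ∈ Ω ↔ x^{(k)} ∈ Λ_k`, likewise
`Ω₀ = B^k(Λ⁰_k)`, `Λ_k ⊆ Λ⁰_k`; `Δ^{(k),L^kε}(Ω,A) ↦ deltaKA C Ω A m² a k` in `L^kε`-units; `dist(x, Ω^{(k)c}) ↦ distC Λ_k`; «A regular» ↦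
the lattice form of (2.23) on `Ω₀`: `|A ⟨z + εe_ν, μ⟩ − A ⟨z, μ⟩| ≦ δ_A`, `z ∈ Ω₀`, with `d²·ε|e|·L^{2k}·δ_A ≦ 1/3`, r14 g14's threshold).

v1.1 (DOC-ONLY, ref-4 S-B1-g42-1): the [13] p. 594 sentence of v1 was a misquote (not printed); replaced above by the printed pp. 593–594 text;
no declaration changed.

WHAT THIS FILE PROVES (kernel-checked, zero `sorry`, theorems only; axioms standard).
* §1 general-`A` plumbing: `siteInner_propagatorK_le_of_coercive_cov` (`⟨g, G^ε_k(Ω,A)g⟩ ≤ γ⁻¹(L^kε)²‖g‖²` from a coercivity constant on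
  the `Ω`-supported fields), `source_supported_cov` (`Q_k^*(A)e_p` is supported in `B^k(x_p) ⊆ Ω`), `covDeriv_smul_fun`.
* §2 the IMS localisation at a general `A`: **`ims_identity_cov`** (`⟨θφ, H_A(θφ)⟩ = ⟨θ²φ, H_Aφ⟩ + Σ_{b⊂Ω}ε^{d−2}(θ(b₊) − θ(b₋))²
  ⟨U(A_b)φ(b₊), φ(b₋)⟩ − ½a_k(L^kε)⁻²Σ_y(L^kε)^dL^{−2kd}Σ_{x,x′∈B^k(y)}(θ(x) − θ(x′))²⟨U(A(Γ_{y,x}))φ(x), U(A(Γ_{y,x′}))φ(x′)⟩`),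
  `bond_comm_le_cov`, `siteInner_indicator_transport`, **`form_cutoff_le_cov`** (`⟨θφ, H_A(θφ)⟩ ≤ (d·s²ε⁻² + ½a_k(L^kε)⁻²)‖1_Sφ‖²`, `φ =
  G^ε_k(Ω,A)u`, `θ ≡ 0` on `supp u`).
* §3 **`diag_le_trivial_reg`**, **`diag_decay_reg`** — the diagonal decay of the energy-comparison form at a regular `A`:
  `⟨Q_k^*(A)e_p, (G^ε_k(Ω,A) − G^ε_k(Ω₀,A))Q_k^*(A)e_p⟩ ≤ e^{6δ}((d + a/2)(2/γ₀)² + γ₀⁻¹)(L^kε)²e^{−2δω}(L^kε)^d` for `ω ≤ dist(x_p, Λ⁰_k ∖ Λ_k)`,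
  `γ₀ = min{2, a(1 − L⁻²)/4}`, `(4d + 4a)δ ≤ γ₀`.
* §4 **`offdiag_pairing_reg`**, **`ineq229_regular_region`** — (2.28)–(2.29) AT A REGULAR `A` FOR NESTED REGIONS with the explicit
  constant `a²·½(K₁ + K₂)·(L^kε)⁻²`, `K₁ = e^{6δ}((d + a/2)(2/γ₀)² + γ₀⁻¹)`, `K₂ = (4/γ₀)e^{δ}`, rate `δ/2`, any weight `w ≤ dist(·, Λ⁰_k ∖ Λ_k)`;
  **`ineq229_regular_region_distC`** (the printed weight `dist(·, Ω^{(k)c})`); **`prop22_second_regular_region`** — THE PRINTED QUANTIFIER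
  SHAPE: `∀ d, L > 1, a > 0 ∃ δ₀ c₀ > 0` (functions of `d, L, a` only) for every torus of the model with these `d, L`, every `N`, charge,
  `m² > 0`, `1 ≤ k ≤ K`, every nested pair of block unions, EVERY `A` regular on `Ω₀` below the threshold, all `x_p, x_q ∈ Λ_k`.
HONEST SCOPE / DIVERGENCE.  (i) Regularity of `A` asked on `Ω₀` (the print: «regular in the same sense as in Proposition 2.1», i.e. on
the region) with r14 g14's smallness `d²·ε|e|·L^{2k}·δ_A ≦ 1/3` — the print's *"for e(L^kε) sufficiently small"* made explicit, see
`B1Cor23RegularRegion.cor23_first_reg223_region` for the (2.23) currency; (ii) `Λ_k ⊆ Λ⁰_k` arbitrary sets of block sites (weaker than «big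
blocks»); `Ω₀ = T_ε` allowed; (iii) METHOD: energy comparison + Combes–Thomas (r14 g12/g14), NOT the print's random-walk expansion; constants
explicit and crude; `m² > 0` needed only for invertibility; (iv) value = the `A ≠ 0`, nested-region case of Prop. 2.2 (2.28)–(2.29) now holds
outright on the concrete carrier below the coupling threshold; NOT summit progress.
-/

noncomputable section

open scoped BigOperators InnerProductSpace Matrix

namespace Literature.MathematicalPhysics.QuantumFieldTheory.Balaban1983to89.B1Ineq229RegularRegion

open HiggsLattice HiggsAveraging HiggsCovariance HiggsCovariancePos B1Eq230FluctCov
open HiggsFluctMeasure (coeff221)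
open HiggsFluctMeasurePos (siteInner_comm siteInner_add_right siteInner_sub_right siteInner_smul_right
  siteInner_smul_left)
open B1Eq230FluctCovPos (siteInner_covOpK_comm siteInner_propagatorK_comm)
open HiggsCovarianceCont (sNorm sNorm_nonneg sNorm_sq abs_siteInner_le)
open B2Restr216Lattice (norm_U_apply)
open B1Cor23RegularRegion (siteInner_covOpK_eq covDeriv_eq propagatorK_supported propagatorK_pairing_regular_region
  delta_admissible)
open B1Ineq18RegularRegion (coercive_covOpK_regular_region_uniform gammaReg_pos)
open B1Ineq229ZeroFieldRegion (two_mul_siteInner_sub_form_le siteInner_propagatorK_eq_variational siteInner_propagatorK_anti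
  abs_siteInner_propagatorK_sub_le siteInner_propagatorK_sub_self_nonneg siteInner_covOpK_eq_of_vanish siteInner_sub_le_form_cutoff
  block_comm_le sum_blockK_sum blockUnion_of_iff subset_of_iff far_from_defect mat_deltaKA_sub_eq)
open Matrix

variable {P : HiggsLattice.Params} {N : ℕ} {k : ℕ}

/-! ## §1 General-`A` plumbing -/

section Plumbing

variable (C : ChargeData N) (Ω : Finset (HiggsLattice.Site P 0)) (A : HiggsLattice.VecField P 0) {msq : ℝ} (a : ℝ)

/-- **An upper bound from a coercivity constant, every `A`**: if `γ(L^kε)^{−2}‖w‖² ≤ ⟨w, H_Aw⟩` for the fields `w` supported in `Ω`, `Ω` a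
union of `k`-fold blocks (so that `G^ε_k(Ω,A)` preserves the `Ω`-supported fields, r14 g14 `propagatorK_supported`), then for `g` supported
in `Ω`: `⟨g, G^ε_k(Ω,A)g⟩ ≤ γ^{−1}(L^kε)²‖g‖²`. [cite: Balaban1982Higgs1, (2.20) p.610] -/
theorem siteInner_propagatorK_le_of_coercive_cov
    (hΩ : ∀ x x' : HiggsLattice.Site P 0, blockIter k x = blockIter k x' → (x ∈ Ω ↔ x' ∈ Ω))
    (hmsq : 0 < msq) (hak : 0 ≤ B1.aSeq a P.L k) {γ : ℝ} (hγ : 0 < γ)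
    (hlow : ∀ w : ScalarField P 0 N, (∀ x, x ∉ Ω → w x = 0) →
      γ * ((P.mesh k)⁻¹ ^ 2) * siteInner w w ≤ siteInner w (covOpK C Ω A msq a k w))
    (g : ScalarField P 0 N) (hg : ∀ x, x ∉ Ω → g x = 0) :
    siteInner g (propagatorK C Ω A msq a k g) ≤ γ⁻¹ * P.mesh k ^ 2 * siteInner g g := by
  set φ := propagatorK C Ω A msq a k g with hφ
  have hφsupp : ∀ x, x ∉ Ω → φ x = 0 := propagatorK_supported C Ω A hmsq hak hΩ g hg
  have h1 := siteInner_propagatorK_eq_variational C Ω A a hmsq hak g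
  have h2 := hlow φ hφsupp
  have hM : 0 < P.mesh k := P.mesh_pos k
  have hcs : siteInner g φ ≤ sNorm g * sNorm φ := HiggsFluctMeasurePos.siteInner_le_sNorm_mul g φ
  have hgg : siteInner g g = sNorm g ^ 2 := (sNorm_sq g).symm
  have hφφ : siteInner φ φ = sNorm φ ^ 2 := (sNorm_sq φ).symm
  rw [hgg]
  rw [hφφ] at h2
  have hsq : 0 ≤ (γ * (P.mesh k)⁻¹ * sNorm φ - P.mesh k * sNorm g) ^ 2 := sq_nonneg _
  have hinv : (P.mesh k)⁻¹ * P.mesh k = 1 := inv_mul_cancel₀ hM.ne'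
  have hγinv : γ⁻¹ * γ = 1 := inv_mul_cancel₀ hγ.ne'
  have key : 2 * (sNorm g * sNorm φ) - γ * ((P.mesh k)⁻¹ ^ 2) * sNorm φ ^ 2 ≤ γ⁻¹ * P.mesh k ^ 2 * sNorm g ^ 2 := by
    have h := mul_nonneg (inv_pos.mpr hγ).le hsq
    have e : γ⁻¹ * (γ * (P.mesh k)⁻¹ * sNorm φ - P.mesh k * sNorm g) ^ 2
        = γ * ((P.mesh k)⁻¹ ^ 2) * sNorm φ ^ 2
          - 2 * ((γ⁻¹ * γ) * ((P.mesh k)⁻¹ * P.mesh k)) * (sNorm g * sNorm φ)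
          + γ⁻¹ * P.mesh k ^ 2 * sNorm g ^ 2 := by
      field_simp
      ring
    rw [e, hinv, hγinv] at h
    linarith
  linarith

/-- The block source `u_p = Q_k^*(A)e_p` of (2.21) is supported in `B^k(x_p) ⊆ Ω` for `x_p ∈ Λ_k`, every `A`.
[cite: Balaban1982Higgs1, (2.21) p.610] -/
theorem source_supported_cov {Λk : Finset (HiggsLattice.Site P k)} (hΩΛ : ∀ x, x ∈ Ω ↔ blockIter k x ∈ Λk)
    (p : HiggsLattice.Site P k × Ix N) (hp : p.1 ∈ Λk) :
    ∀ x, x ∉ Ω → avgQkAdj C A k (cb P N k p) x = 0 := by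
  intro x hx
  by_contra h
  have hb : blockIter k x = p.1 := by
    by_contra h'
    exact h (B1Ineq234Concrete.avgQkAdj_cb_eq_zero C A p h')
  exact hx ((hΩΛ x).mpr (hb ▸ hp))

/-- The covariant derivative of a field multiplied by a real function: `(D^ε_A(cφ))(b) = ε⁻¹(c(b₊)U(A_b)φ(b₊) − c(b₋)φ(b₋))`.
[cite: Balaban1982Higgs1, (1.7) p.605] -/
theorem covDeriv_smul_fun (c : HiggsLattice.Site P 0 → ℝ) (φ : ScalarField P 0 N) (b : HiggsLattice.PBond P 0) :
    covDeriv C A (fun x => c x • φ x) b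
      = (P.mesh 0)⁻¹ • (c b.tgt • C.U (P.mesh 0) (A b) (φ b.tgt) - c b.src • φ b.src) := by
  unfold HiggsLattice.covDeriv
  rw [ContinuousLinearMap.map_smul]

end Plumbing

/-! ## §2 The IMS localisation at a general `A` -/

section IMS

variable (C : ChargeData N) {msq : ℝ} (a : ℝ)

/-- The one-bond IMS identity in `ℝ^N`: `|m(tu − t′v)|² = ⟨m(t²u − t′²v), m(u − v)⟩ + m²(t − t′)²⟨u, v⟩`. [folklore] -/
private theorem inner_bond_ims (m t t' : ℝ) (u v : E N) :
    ⟪m • (t • u - t' • v), m • (t • u - t' • v)⟫_ℝ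
      = ⟪m • (t ^ 2 • u - t' ^ 2 • v), m • (u - v)⟫_ℝ + m ^ 2 * ((t - t') ^ 2 * ⟪u, v⟫_ℝ) := by
  simp only [inner_smul_left, inner_smul_right, inner_sub_left, inner_sub_right, RCLike.conj_to_real]
  rw [real_inner_comm u v]
  ring

/-- The one-block IMS identity (symmetrisation). [folklore] -/
private theorem block_ims (B : Finset (HiggsLattice.Site P 0)) (θ : HiggsLattice.Site P 0 → ℝ) (φ : ScalarField P 0 N) :
    ∑ x ∈ B, ∑ x' ∈ B, ⟪θ x • φ x, θ x' • φ x'⟫_ℝ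
      = (∑ x ∈ B, ∑ x' ∈ B, ⟪θ x ^ 2 • φ x, φ x'⟫_ℝ)
        - (1 / 2) * ∑ x ∈ B, ∑ x' ∈ B, (θ x - θ x') ^ 2 * ⟪φ x, φ x'⟫_ℝ := by
  have hsymm : ∑ x ∈ B, ∑ x' ∈ B, θ x' ^ 2 * ⟪φ x, φ x'⟫_ℝ = ∑ x ∈ B, ∑ x' ∈ B, θ x ^ 2 * ⟪φ x, φ x'⟫_ℝ := by
    rw [Finset.sum_comm]
    exact Finset.sum_congr rfl fun x _ => Finset.sum_congr rfl fun x' _ => by rw [real_inner_comm]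
  have e1 : ∑ x ∈ B, ∑ x' ∈ B, ⟪θ x • φ x, θ x' • φ x'⟫_ℝ = ∑ x ∈ B, ∑ x' ∈ B, θ x * θ x' * ⟪φ x, φ x'⟫_ℝ := by
    refine Finset.sum_congr rfl fun x _ => Finset.sum_congr rfl fun x' _ => ?_
    simp only [inner_smul_left, inner_smul_right, RCLike.conj_to_real]
    ring
  have e2 : ∑ x ∈ B, ∑ x' ∈ B, ⟪θ x ^ 2 • φ x, φ x'⟫_ℝ = ∑ x ∈ B, ∑ x' ∈ B, θ x ^ 2 * ⟪φ x, φ x'⟫_ℝ := by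
    refine Finset.sum_congr rfl fun x _ => Finset.sum_congr rfl fun x' _ => ?_
    simp only [inner_smul_left, RCLike.conj_to_real]
  have e3 : ∑ x ∈ B, ∑ x' ∈ B, (θ x - θ x') ^ 2 * ⟪φ x, φ x'⟫_ℝ
      = (∑ x ∈ B, ∑ x' ∈ B, θ x ^ 2 * ⟪φ x, φ x'⟫_ℝ) + (∑ x ∈ B, ∑ x' ∈ B, θ x' ^ 2 * ⟪φ x, φ x'⟫_ℝ)
        - 2 * ∑ x ∈ B, ∑ x' ∈ B, θ x * θ x' * ⟪φ x, φ x'⟫_ℝ := by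
    have h : ∀ x x', (θ x - θ x') ^ 2 * ⟪φ x, φ x'⟫_ℝ
        = (θ x ^ 2 * ⟪φ x, φ x'⟫_ℝ + θ x' ^ 2 * ⟪φ x, φ x'⟫_ℝ) - 2 * (θ x * θ x' * ⟪φ x, φ x'⟫_ℝ) := by
      intro x x'
      ring
    simp only [h, Finset.sum_sub_distrib, Finset.sum_add_distrib, ← Finset.mul_sum]
  rw [e1, e2, e3, hsymm]
  ring

/-- **The IMS identity for `H = −Δ^{ε,N}_{A,Ω} + m² + a_k(L^kε)⁻²P_k(A)` and a real cut-off `θ`, GENERAL `A`**: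
`⟨θφ, H(θφ)⟩ = ⟨θ²φ, Hφ⟩ + Σ_{b⊂Ω}ε^{d−2}(θ(b₊) − θ(b₋))²⟨U(A_b)φ(b₊), φ(b₋)⟩
 − ½a_k(L^kε)⁻²Σ_y(L^kε)^dL^{−2kd}Σ_{x,x′∈B^k(y)}(θ(x) − θ(x′))²⟨U(A(Γ_{y,x}))φ(x), U(A(Γ_{y,x′}))φ(x′)⟩` — the zero-field identity of r14
g12 with the transported pair on each bond and the transported field in each block (`U` is `ℝ`-linear, so it commutes with `θ`).
[folklore] [cite: Balaban1982Higgs1, (2.20) p.610] -/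
theorem ims_identity_cov (Ω : Finset (HiggsLattice.Site P 0)) (A : HiggsLattice.VecField P 0) (msq a : ℝ) (k : ℕ)
    (θ : HiggsLattice.Site P 0 → ℝ) (φ : ScalarField P 0 N) :
    siteInner (fun x => θ x • φ x) (covOpK C Ω A msq a k (fun x => θ x • φ x))
      = siteInner (fun x => θ x ^ 2 • φ x) (covOpK C Ω A msq a k φ)
        + (∑ b : HiggsLattice.PBond P 0, if Inside Ω b then
            P.mesh 0 ^ P.d * (((P.mesh 0)⁻¹) ^ 2 *
              ((θ b.tgt - θ b.src) ^ 2 * ⟪C.U (P.mesh 0) (A b) (φ b.tgt), φ b.src⟫_ℝ)) else 0)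
        - B1.aSeq a P.L k * ((P.mesh k)⁻¹ ^ 2) *
          ∑ y : HiggsLattice.Site P k, P.mesh k ^ P.d * ((((P.L : ℝ) ^ (k * P.d))⁻¹) ^ 2 *
            ((1 / 2) * ∑ x ∈ blockK k y, ∑ x' ∈ blockK k y, (θ x - θ x') ^ 2 *
              ⟪C.U (P.mesh 0) (multiContourSum A k x) (φ x), C.U (P.mesh 0) (multiContourSum A k x') (φ x')⟫_ℝ)) := by
  rw [siteInner_covOpK_eq, siteInner_covOpK_eq]
  -- the transported field in the blocks
  set v : ScalarField P 0 N := fun x => C.U (P.mesh 0) (multiContourSum A k x) (φ x) with hv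
  have htr : ∀ x, C.U (P.mesh 0) (multiContourSum A k x) (θ x • φ x) = θ x • v x := fun x => by
    rw [ContinuousLinearMap.map_smul]
  have htr2 : ∀ x, C.U (P.mesh 0) (multiContourSum A k x) (θ x ^ 2 • φ x) = θ x ^ 2 • v x := fun x => by
    rw [ContinuousLinearMap.map_smul]
  simp_rw [htr, htr2]
  -- the bond part
  have hB : (∑ b : HiggsLattice.PBond P 0, if Inside Ω b then
        P.mesh 0 ^ P.d * ⟪covDeriv C A (fun x => θ x • φ x) b, covDeriv C A (fun x => θ x • φ x) b⟫_ℝ else 0)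
      = (∑ b : HiggsLattice.PBond P 0, if Inside Ω b then
          P.mesh 0 ^ P.d * ⟪covDeriv C A (fun x => θ x ^ 2 • φ x) b, covDeriv C A φ b⟫_ℝ else 0)
        + ∑ b : HiggsLattice.PBond P 0, if Inside Ω b then
            P.mesh 0 ^ P.d * (((P.mesh 0)⁻¹) ^ 2 *
              ((θ b.tgt - θ b.src) ^ 2 * ⟪C.U (P.mesh 0) (A b) (φ b.tgt), φ b.src⟫_ℝ)) else 0 := by
    rw [← Finset.sum_add_distrib]
    refine Finset.sum_congr rfl fun b _ => ?_
    split_ifs with hb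
    · rw [covDeriv_smul_fun, covDeriv_smul_fun, covDeriv_eq, inner_bond_ims]
      ring
    · simp
  have hM : siteInner (fun x => θ x • φ x) (fun x => θ x • φ x) = siteInner (fun x => θ x ^ 2 • φ x) φ := by
    unfold siteInner
    refine Finset.sum_congr rfl fun x _ => ?_
    simp only [inner_smul_left, inner_smul_right, RCLike.conj_to_real]
    ring
  have hP : (∑ y : HiggsLattice.Site P k, P.mesh k ^ P.d * ((((P.L : ℝ) ^ (k * P.d))⁻¹) ^ 2 *
        ∑ x ∈ blockK k y, ∑ x' ∈ blockK k y, ⟪θ x • v x, θ x' • v x'⟫_ℝ))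
      = (∑ y : HiggsLattice.Site P k, P.mesh k ^ P.d * ((((P.L : ℝ) ^ (k * P.d))⁻¹) ^ 2 *
          ∑ x ∈ blockK k y, ∑ x' ∈ blockK k y, ⟪θ x ^ 2 • v x, v x'⟫_ℝ))
        - ∑ y : HiggsLattice.Site P k, P.mesh k ^ P.d * ((((P.L : ℝ) ^ (k * P.d))⁻¹) ^ 2 *
            ((1 / 2) * ∑ x ∈ blockK k y, ∑ x' ∈ blockK k y, (θ x - θ x') ^ 2 * ⟪v x, v x'⟫_ℝ)) := by
    rw [← Finset.sum_sub_distrib]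
    refine Finset.sum_congr rfl fun y _ => ?_
    rw [block_ims]
    ring
  rw [hB, hM, hP]
  ring

/-- **The Laplacian commutator term is small, general `A`**: if `|θ(b₊) − θ(b₋)| ≤ s` on every bond and every bond on which `θ`
changes has both endpoints in `S`, then `Σ_{b⊂Ω}ε^{d−2}(θ(b₊) − θ(b₋))²⟨U(A_b)φ(b₊), φ(b₋)⟩ ≤ d·s²·ε⁻²‖1_Sφ‖²` (`‖U(A_b)v‖ = ‖v‖`).
[folklore] [cite: Balaban1983RegularityDecay, (5.5) p.594] -/
theorem bond_comm_le_cov (Ω S : Finset (HiggsLattice.Site P 0)) (A : HiggsLattice.VecField P 0)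
    (θ : HiggsLattice.Site P 0 → ℝ) (φ : ScalarField P 0 N) {s : ℝ}
    (hθb : ∀ b : HiggsLattice.PBond P 0, |θ b.tgt - θ b.src| ≤ s)
    (hS : ∀ b : HiggsLattice.PBond P 0, θ b.tgt ≠ θ b.src → b.src ∈ S ∧ b.tgt ∈ S) :
    (∑ b : HiggsLattice.PBond P 0, if Inside Ω b then
        P.mesh 0 ^ P.d * (((P.mesh 0)⁻¹) ^ 2 *
          ((θ b.tgt - θ b.src) ^ 2 * ⟪C.U (P.mesh 0) (A b) (φ b.tgt), φ b.src⟫_ℝ)) else 0)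
      ≤ P.d * s ^ 2 * ((P.mesh 0)⁻¹ ^ 2) *
        siteInner (fun x => if x ∈ S then φ x else (0 : E N)) (fun x => if x ∈ S then φ x else (0 : E N)) := by
  set g : ScalarField P 0 N := fun x => if x ∈ S then φ x else 0 with hg
  have hm : 0 < P.mesh 0 := P.mesh_pos 0
  have hterm : ∀ b : HiggsLattice.PBond P 0,
      (if Inside Ω b then P.mesh 0 ^ P.d * (((P.mesh 0)⁻¹) ^ 2 *
          ((θ b.tgt - θ b.src) ^ 2 * ⟪C.U (P.mesh 0) (A b) (φ b.tgt), φ b.src⟫_ℝ)) else 0)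
        ≤ ((P.mesh 0)⁻¹ ^ 2) * s ^ 2 / 2 * (P.mesh 0 ^ P.d * ‖g b.tgt‖ ^ 2)
          + ((P.mesh 0)⁻¹ ^ 2) * s ^ 2 / 2 * (P.mesh 0 ^ P.d * ‖g b.src‖ ^ 2) := by
    intro b
    have hnn : 0 ≤ ((P.mesh 0)⁻¹ ^ 2) * s ^ 2 / 2 * (P.mesh 0 ^ P.d * ‖g b.tgt‖ ^ 2)
        + ((P.mesh 0)⁻¹ ^ 2) * s ^ 2 / 2 * (P.mesh 0 ^ P.d * ‖g b.src‖ ^ 2) := by positivity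
    by_cases hb : Inside Ω b
    · rw [if_pos hb]
      by_cases hθ : θ b.tgt = θ b.src
      · rw [hθ, sub_self]
        simpa using hnn
      · obtain ⟨hsS, htS⟩ := hS b hθ
        have hgt : g b.tgt = φ b.tgt := by rw [hg]; exact if_pos htS
        have hgs : g b.src = φ b.src := by rw [hg]; exact if_pos hsS
        rw [← hgt, ← hgs]
        have hinner : |⟪C.U (P.mesh 0) (A b) (g b.tgt), g b.src⟫_ℝ| ≤ (‖g b.tgt‖ ^ 2 + ‖g b.src‖ ^ 2) / 2 := by
          have h1 := abs_real_inner_le_norm (C.U (P.mesh 0) (A b) (g b.tgt)) (g b.src)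
          rw [norm_U_apply] at h1
          nlinarith [sq_nonneg (‖g b.tgt‖ - ‖g b.src‖)]
        have hsq : (θ b.tgt - θ b.src) ^ 2 ≤ s ^ 2 := by
          have := hθb b
          rw [← sq_abs]
          exact pow_le_pow_left₀ (abs_nonneg _) this 2
        have hle : (θ b.tgt - θ b.src) ^ 2 * ⟪C.U (P.mesh 0) (A b) (g b.tgt), g b.src⟫_ℝ
            ≤ s ^ 2 * ((‖g b.tgt‖ ^ 2 + ‖g b.src‖ ^ 2) / 2) := by
          calc (θ b.tgt - θ b.src) ^ 2 * ⟪C.U (P.mesh 0) (A b) (g b.tgt), g b.src⟫_ℝ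
              ≤ (θ b.tgt - θ b.src) ^ 2 * |⟪C.U (P.mesh 0) (A b) (g b.tgt), g b.src⟫_ℝ| :=
                mul_le_mul_of_nonneg_left (le_abs_self _) (sq_nonneg _)
            _ ≤ s ^ 2 * ((‖g b.tgt‖ ^ 2 + ‖g b.src‖ ^ 2) / 2) :=
                mul_le_mul hsq hinner (abs_nonneg _) (sq_nonneg _)
        have hw : 0 ≤ P.mesh 0 ^ P.d * ((P.mesh 0)⁻¹) ^ 2 := by positivity
        calc P.mesh 0 ^ P.d * (((P.mesh 0)⁻¹) ^ 2 *
              ((θ b.tgt - θ b.src) ^ 2 * ⟪C.U (P.mesh 0) (A b) (g b.tgt), g b.src⟫_ℝ))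
            = (P.mesh 0 ^ P.d * ((P.mesh 0)⁻¹) ^ 2) *
                ((θ b.tgt - θ b.src) ^ 2 * ⟪C.U (P.mesh 0) (A b) (g b.tgt), g b.src⟫_ℝ) := by ring
          _ ≤ (P.mesh 0 ^ P.d * ((P.mesh 0)⁻¹) ^ 2) * (s ^ 2 * ((‖g b.tgt‖ ^ 2 + ‖g b.src‖ ^ 2) / 2)) :=
              mul_le_mul_of_nonneg_left hle hw
          _ = _ := by ring
    · rw [if_neg hb]
      exact hnn
  calc (∑ b : HiggsLattice.PBond P 0, if Inside Ω b then
          P.mesh 0 ^ P.d * (((P.mesh 0)⁻¹) ^ 2 *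
            ((θ b.tgt - θ b.src) ^ 2 * ⟪C.U (P.mesh 0) (A b) (φ b.tgt), φ b.src⟫_ℝ)) else 0)
      ≤ ∑ b : HiggsLattice.PBond P 0, (((P.mesh 0)⁻¹ ^ 2) * s ^ 2 / 2 * (P.mesh 0 ^ P.d * ‖g b.tgt‖ ^ 2)
          + ((P.mesh 0)⁻¹ ^ 2) * s ^ 2 / 2 * (P.mesh 0 ^ P.d * ‖g b.src‖ ^ 2)) := Finset.sum_le_sum fun b _ => hterm b
    _ = ((P.mesh 0)⁻¹ ^ 2) * s ^ 2 / 2 * (∑ b : HiggsLattice.PBond P 0, P.mesh 0 ^ P.d * ‖g b.tgt‖ ^ 2)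
          + ((P.mesh 0)⁻¹ ^ 2) * s ^ 2 / 2 * (∑ b : HiggsLattice.PBond P 0, P.mesh 0 ^ P.d * ‖g b.src‖ ^ 2) := by
        rw [Finset.sum_add_distrib, Finset.mul_sum, Finset.mul_sum]
    _ = ((P.mesh 0)⁻¹ ^ 2) * s ^ 2 / 2 * (P.d * siteInner g g) + ((P.mesh 0)⁻¹ ^ 2) * s ^ 2 / 2 * (P.d * siteInner g g) := by
        rw [B1Ineq233Upper.sum_bond_tgt_sq, B1Ineq233Upper.sum_bond_src_sq]
    _ = P.d * s ^ 2 * ((P.mesh 0)⁻¹ ^ 2) * siteInner g g := by ring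

/-- **The cut transported field has the norm of the cut field**: `‖1_S U(A(Γ))φ‖² = ‖1_Sφ‖²` (unitarity of `U`, sitewise).
[cite: Balaban1982Higgs1, (2.11) p.609] -/
theorem siteInner_indicator_transport (S : Finset (HiggsLattice.Site P 0)) (A : HiggsLattice.VecField P 0) (k : ℕ)
    (φ : ScalarField P 0 N) :
    siteInner (fun x => if x ∈ S then C.U (P.mesh 0) (multiContourSum A k x) (φ x) else (0 : E N))
        (fun x => if x ∈ S then C.U (P.mesh 0) (multiContourSum A k x) (φ x) else (0 : E N))
      = siteInner (fun x => if x ∈ S then φ x else (0 : E N)) (fun x => if x ∈ S then φ x else (0 : E N)) := by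
  rw [siteInner_self_eq, siteInner_self_eq]
  refine Finset.sum_congr rfl fun x _ => ?_
  by_cases hx : x ∈ S
  · rw [if_pos hx, if_pos hx, norm_U_apply]
  · rw [if_neg hx, if_neg hx]

/-- **The IMS bound on the cut-off form, GENERAL `A`**: for `φ = G^ε_k(Ω,A)u`, a cut-off `0 ≤ θ ≤ 1` with `|θ(b₊) − θ(b₋)| ≤ s` on bonds,
VANISHING on the support of `u`, and a set `S` containing both endpoints of every bond and (both members of) every same-block pair on
which `θ` changes: `⟨θφ, H_A(θφ)⟩ ≤ (d·s²·ε⁻² + ½a_k(L^kε)⁻²)·‖1_Sφ‖²` (`k ≤ K`, `m² > 0`, `a_k ≥ 0`).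
[folklore] [cite: Balaban1983RegularityDecay, (5.5) p.594] -/
theorem form_cutoff_le_cov (hk : k ≤ P.K) (Ω S : Finset (HiggsLattice.Site P 0)) (A : HiggsLattice.VecField P 0)
    (hmsq : 0 < msq) (hak : 0 ≤ B1.aSeq a P.L k) (u : ScalarField P 0 N) (θ : HiggsLattice.Site P 0 → ℝ) {s : ℝ}
    (hθ01 : ∀ x, 0 ≤ θ x ∧ θ x ≤ 1) (hθb : ∀ b : HiggsLattice.PBond P 0, |θ b.tgt - θ b.src| ≤ s)
    (hS1 : ∀ b : HiggsLattice.PBond P 0, θ b.tgt ≠ θ b.src → b.src ∈ S ∧ b.tgt ∈ S)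
    (hS2 : ∀ x x' : HiggsLattice.Site P 0, blockIter k x = blockIter k x' → θ x ≠ θ x' → x ∈ S)
    (hθu : ∀ x, u x ≠ 0 → θ x = 0) :
    siteInner (fun x => θ x • propagatorK C Ω A msq a k u x)
        (covOpK C Ω A msq a k (fun x => θ x • propagatorK C Ω A msq a k u x))
      ≤ (P.d * s ^ 2 * ((P.mesh 0)⁻¹ ^ 2) + (1 / 2) * (B1.aSeq a P.L k * ((P.mesh k)⁻¹ ^ 2))) *
        siteInner (fun x => if x ∈ S then propagatorK C Ω A msq a k u x else (0 : E N))
          (fun x => if x ∈ S then propagatorK C Ω A msq a k u x else (0 : E N)) := by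
  set φ := propagatorK C Ω A msq a k u with hφ
  rw [ims_identity_cov C Ω A msq a k θ φ, covOpK_propagatorK_apply C Ω A hmsq a k hak u]
  have h0 : siteInner (fun x => θ x ^ 2 • φ x) u = 0 := by
    unfold siteInner
    refine Finset.sum_eq_zero fun x _ => ?_
    dsimp only
    by_cases hu : u x = 0
    · rw [hu, inner_zero_right, mul_zero]
    · rw [hθu x hu]
      simp
  have h1 := bond_comm_le_cov C Ω S A θ φ hθb hS1
  -- the block term on the transported field
  set v : ScalarField P 0 N := fun x => C.U (P.mesh 0) (multiContourSum A k x) (φ x) with hv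
  have h2 := block_comm_le hk S θ v hθ01 hS2
  rw [siteInner_indicator_transport C S A k φ] at h2
  have h2' := neg_abs_le (∑ y : HiggsLattice.Site P k, P.mesh k ^ P.d * ((((P.L : ℝ) ^ (k * P.d))⁻¹) ^ 2 *
        ((1 / 2) * ∑ x ∈ blockK k y, ∑ x' ∈ blockK k y, (θ x - θ x') ^ 2 * ⟪v x, v x'⟫_ℝ)))
  have hc : 0 ≤ B1.aSeq a P.L k * ((P.mesh k)⁻¹ ^ 2) := by positivity
  rw [h0, zero_add]
  nlinarith [mul_le_mul_of_nonneg_left (h2'.trans' (neg_le_neg h2)) hc]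

end IMS

/-! ## §3 The diagonal decay of the energy-comparison form at a regular `A` -/

section Diagonal

variable (C : ChargeData N) {msq a : ℝ}

open B1Cor23ZeroFieldRegion (exists_weight tdist_le_of_blockIter_eq_real)
open B1Ineq234Concrete (avgQkAdj_cb_eq_zero siteInner_avgQkAdj_cb mul_tdist_blockIter_le)
open B1Ineq234LevelZero (tdist_shift_le_one tdist_comm)

/-- **The trivial bound on the diagonal at a regular `A`**: `0 ≤ D(u_p, u_p) ≤ ⟨u_p, G^ε_k(Ω,A)u_p⟩ ≤ γ₀⁻¹(L^kε)²·(L^kε)^d`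
(`γ₀ = min{2, a(1 − L⁻²)/4}` r14 g14's regular-field region coercivity, `A` regular on `Ω` with `d²·ε|e|·L^{2k}·δ_A ≤ 1/3`,
`‖Q_k^*(A)e_p‖² = (L^kε)^d`). [cite: Balaban1982Higgs1, (2.28) p.611] -/
theorem diag_le_trivial_reg (ha : 0 < a) (hL : 1 < P.L) (hmsq : 0 < msq) (hk1 : 1 ≤ k) (hk : k ≤ P.K)
    {Ω : Finset (HiggsLattice.Site P 0)} (Ω₀ : Finset (HiggsLattice.Site P 0)) {Λk : Finset (HiggsLattice.Site P k)}
    (hΩΛ : ∀ x, x ∈ Ω ↔ blockIter k x ∈ Λk) (A : HiggsLattice.VecField P 0) {δA : ℝ}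
    (hreg : ∀ z ∈ Ω, ∀ μ ν : Fin P.d, |A ⟨z.shift ν, μ⟩ - A ⟨z, μ⟩| ≤ δA)
    (hsmall : (P.d : ℝ) ^ 2 * (P.mesh 0 * |C.e|) * ((P.L : ℝ) ^ k) ^ 2 * δA ≤ 1 / 3)
    (p : HiggsLattice.Site P k × Ix N) (hp : p.1 ∈ Λk) :
    siteInner (avgQkAdj C A k (cb P N k p))
        ((propagatorK C Ω A msq a k - propagatorK C Ω₀ A msq a k) (avgQkAdj C A k (cb P N k p)))
      ≤ (min 2 (a * (1 - ((P.L : ℝ) ^ 2)⁻¹) / 4))⁻¹ * P.mesh k ^ 2 * P.mesh k ^ P.d := by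
  set u := avgQkAdj C A k (cb P N k p) with hu
  have hL' : (1 : ℝ) < (P.L : ℝ) := by exact_mod_cast hL
  have hak : 0 ≤ B1.aSeq a P.L k := (B1.aSeq_pos ha hL' hk1).le
  have hγ := gammaReg_pos (P := P) ha hL
  have husupp := source_supported_cov C Ω A hΩΛ p hp
  have h0 : 0 ≤ siteInner u (propagatorK C Ω₀ A msq a k u) := by
    rw [siteInner_comm]
    exact siteInner_propagatorK_nonneg C Ω₀ _ hmsq a k hak u
  have h1 : siteInner u (propagatorK C Ω A msq a k u)
      ≤ (min 2 (a * (1 - ((P.L : ℝ) ^ 2)⁻¹) / 4))⁻¹ * P.mesh k ^ 2 * siteInner u u := by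
    refine siteInner_propagatorK_le_of_coercive_cov C Ω A a (blockUnion_of_iff hΩΛ) hmsq hak hγ ?_ u husupp
    intro w hw
    have h := coercive_covOpK_regular_region_uniform C (msq := msq) ha hL hk1 hk Ω (blockUnion_of_iff hΩΛ) A hreg hsmall w hw
    have : 0 ≤ msq * siteInner w w := mul_nonneg hmsq.le (siteInner_self_nonneg w)
    linarith
  rw [hu, siteInner_avgQkAdj_cb C _ hk p, ← hu] at h1
  rw [LinearMap.sub_apply, siteInner_sub_right]
  linarith

set_option maxHeartbeats 800000 in
/-- **THE DIAGONAL DECAY OF THE ENERGY-COMPARISON FORM AT A REGULAR `A`** (r14 g12's IMS-localised Dirichlet principle, [13] p. 594, with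
the regular-field inputs of r14 g14): for `Ω = B^k(Λ_k) ⊆ Ω₀ = B^k(Λ⁰_k) ⊆ T_ε`, `1 ≤ k ≤ K`, `m² > 0`, `a > 0`, `L > 1`, `(4d + 4a)δ ≤ γ₀ =
min{2, a(1 − L⁻²)/4}`, `A` regular on `Ω` with `d²·ε|e|·L^{2k}·δ_A ≤ 1/3`, `x_p ∈ Λ_k` and every `ω ≤ dist(x_p, Λ⁰_k ∖ Λ_k)`:
`⟨Q_k^*(A)e_p, (G^ε_k(Ω,A) − G^ε_k(Ω₀,A))Q_k^*(A)e_p⟩ ≤ e^{6δ}((d + a/2)(2/γ₀)² + γ₀⁻¹)·(L^kε)²e^{−2δω}(L^kε)^d`.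
(The proof term is long — the cut-off geometry and the analytic assembly in one declaration, as in r14 g12 —, whence the raised
heartbeat budget.) [cite: Balaban1983RegularityDecay, (5.5) p.594] [cite: Balaban1982Higgs1, (2.29) p.611] -/
theorem diag_decay_reg (ha : 0 < a) (hL : 1 < P.L) (hmsq : 0 < msq) (hk1 : 1 ≤ k) (hk : k ≤ P.K)
    {Ω Ω₀ : Finset (HiggsLattice.Site P 0)} {Λk Λ0k : Finset (HiggsLattice.Site P k)}
    (hΩΛ : ∀ x, x ∈ Ω ↔ blockIter k x ∈ Λk) (hΩ₀Λ₀ : ∀ x, x ∈ Ω₀ ↔ blockIter k x ∈ Λ0k) (hsub : Λk ⊆ Λ0k)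
    (A : HiggsLattice.VecField P 0) {δA : ℝ}
    (hreg : ∀ z ∈ Ω, ∀ μ ν : Fin P.d, |A ⟨z.shift ν, μ⟩ - A ⟨z, μ⟩| ≤ δA)
    (hsmall : (P.d : ℝ) ^ 2 * (P.mesh 0 * |C.e|) * ((P.L : ℝ) ^ k) ^ 2 * δA ≤ 1 / 3)
    {δ : ℝ} (hδ0 : 0 ≤ δ) (hδ : (4 * P.d + 4 * a) * δ ≤ min 2 (a * (1 - ((P.L : ℝ) ^ 2)⁻¹) / 4))
    (p : HiggsLattice.Site P k × Ix N) (hp : p.1 ∈ Λk) {ω : ℝ}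
    (hω : ∀ y', y' ∈ Λ0k → y' ∉ Λk → ω ≤ (HiggsLattice.Site.tdist p.1 y' : ℝ)) :
    siteInner (avgQkAdj C A k (cb P N k p))
        ((propagatorK C Ω A msq a k - propagatorK C Ω₀ A msq a k) (avgQkAdj C A k (cb P N k p)))
      ≤ Real.exp (6 * δ) * ((P.d + a / 2) * (2 / min 2 (a * (1 - ((P.L : ℝ) ^ 2)⁻¹) / 4)) ^ 2
          + (min 2 (a * (1 - ((P.L : ℝ) ^ 2)⁻¹) / 4))⁻¹) * P.mesh k ^ 2 * Real.exp (-(2 * δ * ω)) * P.mesh k ^ P.d := by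
  classical
  set γ₀ := min 2 (a * (1 - ((P.L : ℝ) ^ 2)⁻¹) / 4) with hγ₀
  set u := avgQkAdj C A k (cb P N k p) with hu
  set G := propagatorK C Ω A msq a k with hG
  set G₀ := propagatorK C Ω₀ A msq a k with hG₀
  have hL' : (1 : ℝ) < (P.L : ℝ) := by exact_mod_cast hL
  have hak : 0 ≤ B1.aSeq a P.L k := (B1.aSeq_pos ha hL' hk1).le
  have haka : B1.aSeq a P.L k ≤ a := B1.aSeq_le ha hL' k hk1
  have hγ : 0 < γ₀ := gammaReg_pos (P := P) ha hL
  have hM : 0 < P.mesh k := P.mesh_pos k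
  have hMd : 0 < P.mesh k ^ P.d := pow_pos hM _
  have hΩsub : Ω ⊆ Ω₀ := subset_of_iff hΩΛ hΩ₀Λ₀ hsub
  have hΩblk := blockUnion_of_iff hΩΛ
  have husupp := source_supported_cov C Ω A hΩΛ p hp
  have huu : siteInner u u = P.mesh k ^ P.d := by rw [hu]; exact siteInner_avgQkAdj_cb C _ hk p
  -- the trivial bound, valid for every `ω`
  have htriv := diag_le_trivial_reg C ha hL hmsq hk1 hk Ω₀ hΩΛ A hreg hsmall p hp
  rw [← hγ₀, ← hu, ← hG, ← hG₀] at htriv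
  have hK1 : γ₀⁻¹ ≤ (P.d + a / 2) * (2 / γ₀) ^ 2 + γ₀⁻¹ := by
    have : 0 ≤ (P.d + a / 2) * (2 / γ₀) ^ 2 := by positivity
    linarith
  by_cases hω3 : ω < 3
  · have hexp : 1 ≤ Real.exp (6 * δ) * Real.exp (-(2 * δ * ω)) := by
      rw [← Real.exp_add]
      exact Real.one_le_exp (by nlinarith)
    calc siteInner u ((G - G₀) u) ≤ γ₀⁻¹ * P.mesh k ^ 2 * P.mesh k ^ P.d := htriv
      _ = γ₀⁻¹ * P.mesh k ^ 2 * 1 * P.mesh k ^ P.d := by ring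
      _ ≤ ((P.d + a / 2) * (2 / γ₀) ^ 2 + γ₀⁻¹) * P.mesh k ^ 2 * (Real.exp (6 * δ) * Real.exp (-(2 * δ * ω)))
          * P.mesh k ^ P.d := by gcongr
      _ = _ := by ring
  push Not at hω3
  -- the defect set `T = Ω₀ ∖ Ω`; if it is empty the two propagators coincide
  set T := Ω₀ \ Ω with hT
  by_cases hTne : ¬ T.Nonempty
  · have hT0 : Ω₀ \ Ω = ∅ := Finset.not_nonempty_iff_eq_empty.mp hTne
    have hΩ₀sub : Ω₀ ⊆ Ω := Finset.sdiff_eq_empty_iff_subset.mp hT0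
    have heq : Ω = Ω₀ := Finset.Subset.antisymm hΩsub hΩ₀sub
    have hzero : siteInner u ((G - G₀) u) = 0 := by
      rw [hG, hG₀, heq, sub_self, LinearMap.zero_apply]
      simp [siteInner]
    rw [hzero]
    positivity
  push Not at hTne
  obtain ⟨D, hDlip, hDzero, hDnn, hDfar⟩ := exists_weight hTne
  -- the scale `L^k ≥ 2`
  set Lk : ℝ := (P.L : ℝ) ^ k with hLk
  have hLk2 : 2 ≤ Lk := by
    have h2 : (2 : ℝ) ≤ (P.L : ℝ) := by exact_mod_cast hL
    calc (2 : ℝ) = 2 ^ 1 := by norm_num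
      _ ≤ (P.L : ℝ) ^ 1 := pow_le_pow_left₀ (by norm_num) h2 1
      _ ≤ (P.L : ℝ) ^ k := pow_le_pow_right₀ hL'.le hk1
  have hLkpos : 0 < Lk := by linarith
  have hfar : ∀ x, blockIter k x = p.1 → Lk * ω - Lk + 1 ≤ D x := fun x hx =>
    hDfar x _ fun z hz => far_from_defect hk hΩΛ hΩ₀Λ₀ p hω hx hz
  -- the cut-off
  set θ : HiggsLattice.Site P 0 → ℝ := fun x => max (min ((Lk + 1 - D x) / Lk) 1) 0 with hθ
  have hθ01 : ∀ x, 0 ≤ θ x ∧ θ x ≤ 1 := fun x =>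
    ⟨le_max_right _ _, max_le (min_le_right _ _) zero_le_one⟩
  have hθone : ∀ x, D x ≤ 1 → θ x = 1 := by
    intro x hx
    have h1 : 1 ≤ (Lk + 1 - D x) / Lk := by rw [le_div_iff₀ hLkpos]; linarith
    simp only [hθ, min_eq_right h1, max_eq_left (zero_le_one : (0 : ℝ) ≤ 1)]
  have hθzero : ∀ x, Lk + 1 ≤ D x → θ x = 0 := by
    intro x hx
    have h1 : (Lk + 1 - D x) / Lk ≤ 0 := div_nonpos_of_nonpos_of_nonneg (by linarith) hLkpos.le
    simp only [hθ]
    exact max_eq_right ((min_le_left _ _).trans h1)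
  have hθlip : ∀ x z, |θ x - θ z| ≤ |D x - D z| / Lk := by
    intro x z
    calc |θ x - θ z| ≤ |min ((Lk + 1 - D x) / Lk) 1 - min ((Lk + 1 - D z) / Lk) 1| := abs_max_sub_max_le_abs _ _ _
      _ ≤ max |(Lk + 1 - D x) / Lk - (Lk + 1 - D z) / Lk| |(1 : ℝ) - 1| := abs_min_sub_min_le_max _ _ _ _
      _ = |(Lk + 1 - D x) / Lk - (Lk + 1 - D z) / Lk| := by
          rw [sub_self, abs_zero]
          exact max_eq_left (abs_nonneg _)
      _ = |D x - D z| / Lk := by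
          rw [← sub_div, abs_div, abs_of_pos hLkpos]
          congr 1
          rw [show (Lk + 1 - D x) - (Lk + 1 - D z) = -(D x - D z) by ring, abs_neg]
  -- (i) `θ ≡ 1` at the defect bonds
  have hθ1 : ∀ b : HiggsLattice.PBond P 0, Inside Ω₀ b → ¬ Inside Ω b → θ b.src = 1 ∧ θ b.tgt = 1 := by
    intro b hb₀ hb
    have hnear : D b.src ≤ 1 ∧ D b.tgt ≤ 1 := by
      have hbond : |D b.tgt - D b.src| ≤ 1 := by
        refine (hDlip b.tgt b.src).trans ?_
        rw [tdist_comm]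
        exact_mod_cast tdist_shift_le_one b.src b.dir
      by_cases hs : b.src ∈ Ω
      · have ht : b.tgt ∉ Ω := fun ht => hb ⟨hs, ht⟩
        have hT' : b.tgt ∈ T := Finset.mem_sdiff.mpr ⟨hb₀.2, ht⟩
        have h0 := hDzero b.tgt hT'
        rw [h0, zero_sub, abs_neg] at hbond
        exact ⟨(le_abs_self _).trans hbond, by rw [h0]; exact zero_le_one⟩
      · have hT' : b.src ∈ T := Finset.mem_sdiff.mpr ⟨hb₀.1, hs⟩
        have h0 := hDzero b.src hT'
        rw [h0, sub_zero] at hbond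
        exact ⟨by rw [h0]; exact zero_le_one, (le_abs_self _).trans hbond⟩
    exact ⟨hθone _ hnear.1, hθone _ hnear.2⟩
  -- (ii) bond Lipschitz with slope `1/L^k`
  have hθb : ∀ b : HiggsLattice.PBond P 0, |θ b.tgt - θ b.src| ≤ 1 / Lk := by
    intro b
    refine (hθlip b.tgt b.src).trans ?_
    have hbond : |D b.tgt - D b.src| ≤ 1 := by
      refine (hDlip b.tgt b.src).trans ?_
      rw [tdist_comm]
      exact_mod_cast tdist_shift_le_one b.src b.dir
    exact div_le_div_of_nonneg_right hbond hLkpos.le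
  -- (iii) the transition set `S = {dist(·, T) ≤ 2L^k}`
  set S := Finset.univ.filter (fun x : HiggsLattice.Site P 0 => D x ≤ 2 * Lk) with hS
  have hmemS : ∀ x, x ∈ S ↔ D x ≤ 2 * Lk := fun x => by simp [hS]
  have hchange : ∀ x z, θ x ≠ θ z → D x < Lk + 1 ∨ D z < Lk + 1 := by
    intro x z hne
    by_contra h
    push Not at h
    exact hne (by rw [hθzero x h.1, hθzero z h.2])
  have hS1 : ∀ b : HiggsLattice.PBond P 0, θ b.tgt ≠ θ b.src → b.src ∈ S ∧ b.tgt ∈ S := by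
    intro b hne
    have hbond : |D b.tgt - D b.src| ≤ 1 := by
      refine (hDlip b.tgt b.src).trans ?_
      rw [tdist_comm]
      exact_mod_cast tdist_shift_le_one b.src b.dir
    rw [hmemS, hmemS]
    rcases hchange _ _ hne with h | h
    · constructor <;> [linarith [(abs_le.mp hbond).1]; linarith]
    · constructor <;> [linarith; linarith [(abs_le.mp hbond).2]]
  have hS2 : ∀ x x' : HiggsLattice.Site P 0, blockIter k x = blockIter k x' → θ x ≠ θ x' → x ∈ S := by
    intro x x' hxx' hne
    have hblk : |D x - D x'| ≤ Lk - 1 := (hDlip x x').trans (tdist_le_of_blockIter_eq_real hk hxx')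
    rw [hmemS]
    rcases hchange _ _ hne with h | h
    · linarith
    · linarith [(abs_le.mp hblk).2]
  -- (iv) `θ ≡ 0` on the support of `u` (`ω ≥ 3`)
  have hθu : ∀ x, u x ≠ 0 → θ x = 0 := by
    intro x hx
    have hbx : blockIter k x = p.1 := by
      by_contra h'
      exact hx (by rw [hu]; exact avgQkAdj_cb_eq_zero C A p h')
    refine hθzero x ?_
    have := hfar x hbx
    nlinarith
  -- (v) the separation between `S` and the source block
  set r : ℝ := Lk * ω - 3 * Lk + 1 with hr
  have hsep : ∀ x x', (if x ∈ S then G u x else (0 : E N)) ≠ 0 → u x' ≠ 0 →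
      r ≤ (HiggsLattice.Site.tdist x x' : ℝ) := by
    intro x x' hx hx'
    have hxS : x ∈ S := by
      by_contra h
      exact hx (if_neg h)
    have hbx' : blockIter k x' = p.1 := by
      by_contra h'
      exact hx' (by rw [hu]; exact avgQkAdj_cb_eq_zero C A p h')
    have h1 := hfar x' hbx'
    have h2 := (hmemS x).mp hxS
    have h3 : D x' - D x ≤ (HiggsLattice.Site.tdist x x' : ℝ) := by
      rw [tdist_comm]
      exact (le_abs_self _).trans (hDlip x' x)
    linarith
  -- (vi) Combes–Thomas at the regular `A`: `‖1_S Gu‖² ≤ (2/γ₀)²(L^kε)⁴e^{−2δr/L^k}‖u‖²`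
  set g : ScalarField P 0 N := fun x => if x ∈ S then G u x else 0 with hg
  have hgg : siteInner g (G u) = siteInner g g := by
    unfold siteInner
    refine Finset.sum_congr rfl fun x _ => ?_
    by_cases hx : x ∈ S
    · simp [hg, hx]
    · simp [hg, hx]
  have hpair := propagatorK_pairing_regular_region C ha hL hmsq hk1 hk Ω hΩblk A hreg hsmall hδ0 hδ g u husupp r hsep
  rw [← hG, hgg, huu, ← hγ₀] at hpair
  have hB : 0 ≤ 2 / γ₀ * P.mesh k ^ 2 * Real.exp (-(δ * (r / (P.L : ℝ) ^ k))) * Real.sqrt (P.mesh k ^ P.d) := by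
    positivity
  have hsq : siteInner g g ≤ (2 / γ₀ * P.mesh k ^ 2 * Real.exp (-(δ * (r / (P.L : ℝ) ^ k))) *
      Real.sqrt (P.mesh k ^ P.d)) ^ 2 := by
    have hgnn : 0 ≤ siteInner g g := siteInner_self_nonneg g
    have hX : Real.sqrt (siteInner g g) ≤ 2 / γ₀ * P.mesh k ^ 2 * Real.exp (-(δ * (r / (P.L : ℝ) ^ k))) *
        Real.sqrt (P.mesh k ^ P.d) := by
      by_cases h0 : Real.sqrt (siteInner g g) = 0
      · rw [h0]; exact hB
      · have hpos : 0 < Real.sqrt (siteInner g g) := lt_of_le_of_ne (Real.sqrt_nonneg _) (Ne.symm h0)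
        have h := (le_abs_self _).trans hpair
        have h' : Real.sqrt (siteInner g g) * Real.sqrt (siteInner g g) ≤
            (2 / γ₀ * P.mesh k ^ 2 * Real.exp (-(δ * (r / (P.L : ℝ) ^ k))) * Real.sqrt (P.mesh k ^ P.d))
              * Real.sqrt (siteInner g g) :=
          calc Real.sqrt (siteInner g g) * Real.sqrt (siteInner g g) = siteInner g g := Real.mul_self_sqrt hgnn
            _ ≤ _ := h
            _ = _ := by ring
        exact le_of_mul_le_mul_right h' hpos
    calc siteInner g g = Real.sqrt (siteInner g g) ^ 2 := (Real.sq_sqrt hgnn).symm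
      _ ≤ _ := pow_le_pow_left₀ (Real.sqrt_nonneg _) hX 2
  -- (vii) the exponent: `r/L^k ≥ ω − 3`
  have hexp : Real.exp (-(δ * (r / (P.L : ℝ) ^ k))) ^ 2 ≤ Real.exp (6 * δ) * Real.exp (-(2 * δ * ω)) := by
    rw [← Real.exp_nat_mul, ← Real.exp_add]
    apply Real.exp_le_exp.mpr
    rw [← hLk]
    have hrL : ω - 3 ≤ r / Lk := by
      rw [le_div_iff₀ hLkpos, hr]
      nlinarith
    push_cast
    nlinarith
  -- (viii) assemble: the Dirichlet comparison + the IMS bound + (vi)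
  have hcut := siteInner_sub_le_form_cutoff C a hΩsub A hmsq hak u θ hθ1
  have hform := form_cutoff_le_cov C a hk Ω S A hmsq hak u θ hθ01 hθb hS1 hS2 hθu
  rw [← hG, ← hG₀] at hcut
  rw [← hG] at hform
  have hcoef : (P.d * (1 / Lk) ^ 2 * ((P.mesh 0)⁻¹ ^ 2) + (1 / 2) * (B1.aSeq a P.L k * ((P.mesh k)⁻¹ ^ 2)))
      ≤ (P.d + a / 2) * ((P.mesh k)⁻¹ ^ 2) := by
    have hmesh : P.mesh k = Lk * P.mesh 0 := by rw [hLk]; exact B2Ineq329ZeroAveraging.mesh_eq k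
    have hm0 : 0 < P.mesh 0 := P.mesh_pos 0
    have e1 : (1 / Lk) ^ 2 * ((P.mesh 0)⁻¹ ^ 2) = (P.mesh k)⁻¹ ^ 2 := by
      rw [hmesh]; field_simp
    have hd : (0 : ℝ) ≤ P.d := Nat.cast_nonneg _
    have hi : 0 ≤ (P.mesh k)⁻¹ ^ 2 := by positivity
    calc (P.d * (1 / Lk) ^ 2 * ((P.mesh 0)⁻¹ ^ 2) + (1 / 2) * (B1.aSeq a P.L k * ((P.mesh k)⁻¹ ^ 2)))
        = (P.d + B1.aSeq a P.L k / 2) * ((P.mesh k)⁻¹ ^ 2) := by rw [← e1]; ring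
      _ ≤ (P.d + a / 2) * ((P.mesh k)⁻¹ ^ 2) := by gcongr
  have hgnn : 0 ≤ siteInner g g := siteInner_self_nonneg g
  calc siteInner u ((G - G₀) u)
      ≤ (P.d * (1 / Lk) ^ 2 * ((P.mesh 0)⁻¹ ^ 2) + (1 / 2) * (B1.aSeq a P.L k * ((P.mesh k)⁻¹ ^ 2))) * siteInner g g :=
        hcut.trans hform
    _ ≤ ((P.d + a / 2) * ((P.mesh k)⁻¹ ^ 2)) * (2 / γ₀ * P.mesh k ^ 2 * Real.exp (-(δ * (r / (P.L : ℝ) ^ k))) *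
        Real.sqrt (P.mesh k ^ P.d)) ^ 2 := mul_le_mul hcoef hsq hgnn (by positivity)
    _ = (P.d + a / 2) * (2 / γ₀) ^ 2 * P.mesh k ^ 2 * Real.exp (-(δ * (r / (P.L : ℝ) ^ k))) ^ 2 * P.mesh k ^ P.d := by
        rw [mul_pow, mul_pow, mul_pow, Real.sq_sqrt hMd.le]
        field_simp
    _ ≤ (P.d + a / 2) * (2 / γ₀) ^ 2 * P.mesh k ^ 2 * (Real.exp (6 * δ) * Real.exp (-(2 * δ * ω))) * P.mesh k ^ P.d := by
        gcongr
    _ ≤ ((P.d + a / 2) * (2 / γ₀) ^ 2 + γ₀⁻¹) * P.mesh k ^ 2 * (Real.exp (6 * δ) * Real.exp (-(2 * δ * ω)))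
        * P.mesh k ^ P.d := by
        have : 0 ≤ γ₀⁻¹ := (inv_pos.mpr hγ).le
        gcongr
        linarith
    _ = _ := by ring

end Diagonal

/-! ## §4 The off-diagonal interpolation and PROPOSITION 2.2 (2.28)–(2.29) at a regular `A` for nested regions -/

section Assembly

variable (C : ChargeData N) {msq a : ℝ}

open B1Ineq234Concrete (avgQkAdj_cb_eq_zero siteInner_avgQkAdj_cb mul_tdist_blockIter_le mat_QGQ_eq)

/-- **The pairing bound for the energy-comparison form at a regular `A`**: for `x_q ∈ Λ_k` (so that the block source `Q_k^*(A)e_q` is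
supported in `Ω ⊆ Ω₀`) and `A` regular on `Ω₀` with `d²·ε|e|·L^{2k}·δ_A ≤ 1/3`,
`|⟨Q_k^*(A)e_p, (G^ε_k(Ω,A) − G^ε_k(Ω₀,A))Q_k^*(A)e_q⟩| ≤ (4/γ₀)e^{δ}·(L^kε)²e^{−δ|x_p − x_q|}(L^kε)^d` — r14 g14's Cor. 2.3 pairing for
regions at a regular `A` applied to both propagators. [cite: Balaban1983RegularityDecay, Cor. 2.3 (2.30) p.580] [cite: Balaban1982Higgs1, (2.29) p.611] -/
theorem offdiag_pairing_reg (ha : 0 < a) (hL : 1 < P.L) (hmsq : 0 < msq) (hk1 : 1 ≤ k) (hk : k ≤ P.K)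
    {Ω Ω₀ : Finset (HiggsLattice.Site P 0)} {Λk Λ0k : Finset (HiggsLattice.Site P k)}
    (hΩΛ : ∀ x, x ∈ Ω ↔ blockIter k x ∈ Λk) (hΩ₀Λ₀ : ∀ x, x ∈ Ω₀ ↔ blockIter k x ∈ Λ0k) (hsub : Λk ⊆ Λ0k)
    (A : HiggsLattice.VecField P 0) {δA : ℝ}
    (hreg₀ : ∀ z ∈ Ω₀, ∀ μ ν : Fin P.d, |A ⟨z.shift ν, μ⟩ - A ⟨z, μ⟩| ≤ δA)
    (hsmall : (P.d : ℝ) ^ 2 * (P.mesh 0 * |C.e|) * ((P.L : ℝ) ^ k) ^ 2 * δA ≤ 1 / 3)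
    {δ : ℝ} (hδ0 : 0 ≤ δ) (hδ : (4 * P.d + 4 * a) * δ ≤ min 2 (a * (1 - ((P.L : ℝ) ^ 2)⁻¹) / 4))
    (p q : HiggsLattice.Site P k × Ix N) (hq : q.1 ∈ Λk) :
    |siteInner (avgQkAdj C A k (cb P N k p))
        ((propagatorK C Ω A msq a k - propagatorK C Ω₀ A msq a k) (avgQkAdj C A k (cb P N k q)))|
      ≤ 4 / min 2 (a * (1 - ((P.L : ℝ) ^ 2)⁻¹) / 4) * Real.exp δ * P.mesh k ^ 2 *
          Real.exp (-(δ * (HiggsLattice.Site.tdist p.1 q.1 : ℝ))) * P.mesh k ^ P.d := by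
  set γ₀ := min 2 (a * (1 - ((P.L : ℝ) ^ 2)⁻¹) / 4) with hγ₀
  set up := avgQkAdj C A k (cb P N k p) with hup
  set uq := avgQkAdj C A k (cb P N k q) with huq
  have hγ : 0 < γ₀ := gammaReg_pos (P := P) ha hL
  have hT : (0 : ℝ) < (P.L : ℝ) ^ k := pow_pos (by exact_mod_cast P.hL) k
  have hq₀ : q.1 ∈ Λ0k := hsub hq
  have hΩsub : Ω ⊆ Ω₀ := subset_of_iff hΩΛ hΩ₀Λ₀ hsub
  have hreg : ∀ z ∈ Ω, ∀ μ ν : Fin P.d, |A ⟨z.shift ν, μ⟩ - A ⟨z, μ⟩| ≤ δA := fun z hz => hreg₀ z (hΩsub hz)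
  have huqΩ := source_supported_cov C Ω A hΩΛ q hq
  have huqΩ₀ := source_supported_cov C Ω₀ A hΩ₀Λ₀ q hq₀
  -- the separation of the two blocks in `T_ε`
  set R : ℝ := (P.L : ℝ) ^ k * (HiggsLattice.Site.tdist p.1 q.1 : ℝ) - ((P.L : ℝ) ^ k - 1) with hR
  have hRle : ∀ x x', up x ≠ 0 → uq x' ≠ 0 → R ≤ (HiggsLattice.Site.tdist x x' : ℝ) := by
    intro x x' hx hx'
    have hy : blockIter k x = p.1 := by
      by_contra h
      exact hx (by rw [hup]; exact avgQkAdj_cb_eq_zero C A p h)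
    have hy' : blockIter k x' = q.1 := by
      by_contra h
      exact hx' (by rw [huq]; exact avgQkAdj_cb_eq_zero C A q h)
    have h := mul_tdist_blockIter_le hk x x'
    rw [hy, hy'] at h
    have h1 : 1 ≤ P.L ^ k := Nat.one_le_pow _ _ P.hL
    have hcast : ((P.L ^ k : ℕ) : ℝ) * (HiggsLattice.Site.tdist p.1 q.1 : ℝ) ≤
        (HiggsLattice.Site.tdist x x' : ℝ) + (((P.L ^ k : ℕ) : ℝ) - 1) := by
      have := (Nat.cast_le (α := ℝ)).mpr h
      rw [Nat.cast_mul, Nat.cast_add, Nat.cast_sub h1, Nat.cast_one] at this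
      exact this
    rw [Nat.cast_pow] at hcast
    rw [hR]
    linarith
  have hexp : Real.exp (-(δ * (R / (P.L : ℝ) ^ k))) ≤
      Real.exp δ * Real.exp (-(δ * (HiggsLattice.Site.tdist p.1 q.1 : ℝ))) := by
    rw [← Real.exp_add]
    apply Real.exp_le_exp.mpr
    have hRk : R / (P.L : ℝ) ^ k = (HiggsLattice.Site.tdist p.1 q.1 : ℝ) - 1 + ((P.L : ℝ) ^ k)⁻¹ := by
      rw [hR]
      field_simp
      ring
    rw [hRk]
    have : 0 ≤ δ * ((P.L : ℝ) ^ k)⁻¹ := mul_nonneg hδ0 (inv_pos.mpr hT).le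
    nlinarith
  have h1 := propagatorK_pairing_regular_region C ha hL hmsq hk1 hk Ω (blockUnion_of_iff hΩΛ) A hreg hsmall hδ0 hδ
    up uq huqΩ R hRle
  have h2 := propagatorK_pairing_regular_region C ha hL hmsq hk1 hk Ω₀ (blockUnion_of_iff hΩ₀Λ₀) A hreg₀ hsmall hδ0 hδ
    up uq huqΩ₀ R hRle
  rw [← hγ₀, hup, huq, siteInner_avgQkAdj_cb C _ hk p, siteInner_avgQkAdj_cb C _ hk q, ← hup, ← huq] at h1 h2
  have hsq : Real.sqrt (P.mesh k ^ P.d) * Real.sqrt (P.mesh k ^ P.d) = P.mesh k ^ P.d :=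
    Real.mul_self_sqrt (pow_pos (P.mesh_pos k) _).le
  rw [LinearMap.sub_apply, siteInner_sub_right]
  have hnn : 0 ≤ 2 / γ₀ * P.mesh k ^ 2 * (Real.sqrt (P.mesh k ^ P.d) * Real.sqrt (P.mesh k ^ P.d)) := by positivity
  calc |siteInner up (propagatorK C Ω A msq a k uq) - siteInner up (propagatorK C Ω₀ A msq a k uq)|
      ≤ |siteInner up (propagatorK C Ω A msq a k uq)| + |siteInner up (propagatorK C Ω₀ A msq a k uq)| := abs_sub _ _
    _ ≤ 2 * (2 / γ₀ * P.mesh k ^ 2 * Real.exp (-(δ * (R / (P.L : ℝ) ^ k))) *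
          Real.sqrt (P.mesh k ^ P.d) * Real.sqrt (P.mesh k ^ P.d)) := by linarith
    _ = 2 * (2 / γ₀ * P.mesh k ^ 2 * (Real.sqrt (P.mesh k ^ P.d) * Real.sqrt (P.mesh k ^ P.d)))
          * Real.exp (-(δ * (R / (P.L : ℝ) ^ k))) := by ring
    _ ≤ 2 * (2 / γ₀ * P.mesh k ^ 2 * (Real.sqrt (P.mesh k ^ P.d) * Real.sqrt (P.mesh k ^ P.d)))
          * (Real.exp δ * Real.exp (-(δ * (HiggsLattice.Site.tdist p.1 q.1 : ℝ)))) :=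
        mul_le_mul_of_nonneg_left hexp (by positivity)
    _ = _ := by rw [hsq]; ring

/-- Interpolation: `|X| ≤ A`, `|X| ≤ B` ⟹ `|X| ≤ (AB)^{1/2}`. [folklore] -/
private theorem abs_le_sqrt_mul_of_le {X A B : ℝ} (hA : |X| ≤ A) (hB : |X| ≤ B) : |X| ≤ Real.sqrt (A * B) := by
  have h0 : 0 ≤ |X| := abs_nonneg X
  have h := mul_le_mul hA hB h0 (h0.trans hA)
  calc |X| = Real.sqrt (|X| * |X|) := (Real.sqrt_mul_self h0).symm
    _ ≤ Real.sqrt (A * B) := Real.sqrt_le_sqrt h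

/-- **PROPOSITION 2.2 (2.28)–(2.29) AT A REGULAR `A ≠ 0` FOR NESTED REGIONS ON THE CONCRETE (Higgs)₂,₃ CARRIER, explicit constants.**
For `Ω = B^k(Λ_k) ⊆ Ω₀ = B^k(Λ⁰_k) ⊆ T_ε` (`Λ_k ⊆ Λ⁰_k ⊂ T^{(k)}_1` arbitrary — `Ω₀ = T_ε` allowed —, `k = j + 1`, `1 ≤ k ≤ K`), `m² > 0`,
`a > 0`, `L > 1`, every torus / charge data / `N` of the model, every `δ ≥ 0` with `(4d + 4a)δ ≤ γ₀ = min{2, a(1 − L⁻²)/4}`, EVERY `A`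
regular on `Ω₀` (`|A ⟨z + εe_ν, μ⟩ − A ⟨z, μ⟩| ≤ δ_A`, `z ∈ Ω₀`) with `d²·ε|e|·L^{2k}·δ_A ≤ 1/3`, every weight `w` on `T^{(k)}` dominated by
the distance to the defect set (`w(y) ≤ |y − y′|` for all `y′ ∈ Λ⁰_k ∖ Λ_k`), and all `x_p, x_q ∈ Λ_k`:
`|(Δ^{(k),L^kε}(Ω,A) − Δ^{(k),L^kε}(Ω₀,A))(p,q)| ≤ a²·½(K₁ + K₂)·(L^kε)⁻²·e^{−(δ/2)(|x_p−x_q| + w(x_p) + w(x_q))}`, `K₁ = e^{6δ}((d + a/2)(2/γ₀)² +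
γ₀⁻¹)`, `K₂ = (4/γ₀)e^{δ}` — constants functions of `(d, L, a, δ)` ONLY (independent of `ε`, the torus, `k`, `Λ_k`, `Λ⁰_k`, `m²`, `N` and `A`).
[cite: Balaban1982Higgs1, Prop. 2.2 (2.28)–(2.29) p.611] [cite: Balaban1983RegularityDecay, (5.5) p.594] -/
theorem ineq229_regular_region (ha : 0 < a) (hL : 1 < P.L) (hmsq : 0 < msq) (j : ℕ) (hk : j + 1 ≤ P.K)
    (Ω Ω₀ : Finset (HiggsLattice.Site P 0)) (Λk Λ0k : Finset (HiggsLattice.Site P (j + 1)))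
    (hΩΛ : ∀ x, x ∈ Ω ↔ blockIter (j + 1) x ∈ Λk) (hΩ₀Λ₀ : ∀ x, x ∈ Ω₀ ↔ blockIter (j + 1) x ∈ Λ0k) (hsub : Λk ⊆ Λ0k)
    (A : HiggsLattice.VecField P 0) {δA : ℝ}
    (hreg₀ : ∀ z ∈ Ω₀, ∀ μ ν : Fin P.d, |A ⟨z.shift ν, μ⟩ - A ⟨z, μ⟩| ≤ δA)
    (hsmall : (P.d : ℝ) ^ 2 * (P.mesh 0 * |C.e|) * ((P.L : ℝ) ^ (j + 1)) ^ 2 * δA ≤ 1 / 3)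
    {δ : ℝ} (hδ0 : 0 ≤ δ) (hδ : (4 * P.d + 4 * a) * δ ≤ min 2 (a * (1 - ((P.L : ℝ) ^ 2)⁻¹) / 4))
    (w : HiggsLattice.Site P (j + 1) → ℝ)
    (hw : ∀ y y', y' ∈ Λ0k → y' ∉ Λk → w y ≤ (HiggsLattice.Site.tdist y y' : ℝ))
    (p q : HiggsLattice.Site P (j + 1) × Ix N) (hp : p.1 ∈ Λk) (hq : q.1 ∈ Λk) :
    |mat (deltaKA C Ω A msq a (j + 1)) p q - mat (deltaKA C Ω₀ A msq a (j + 1)) p q| ≤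
      a ^ 2 * ((Real.exp (6 * δ) * ((P.d + a / 2) * (2 / min 2 (a * (1 - ((P.L : ℝ) ^ 2)⁻¹) / 4)) ^ 2
          + (min 2 (a * (1 - ((P.L : ℝ) ^ 2)⁻¹) / 4))⁻¹)
          + 4 / min 2 (a * (1 - ((P.L : ℝ) ^ 2)⁻¹) / 4) * Real.exp δ) / 2) *
        ((P.mesh (j + 1))⁻¹ ^ 2) *
        Real.exp (-(δ / 2 * ((HiggsLattice.Site.tdist p.1 q.1 : ℝ) + w p.1 + w q.1))) := by
  set γ₀ := min 2 (a * (1 - ((P.L : ℝ) ^ 2)⁻¹) / 4) with hγ₀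
  set K₁ := Real.exp (6 * δ) * ((P.d + a / 2) * (2 / γ₀) ^ 2 + γ₀⁻¹) with hK₁
  set K₂ := 4 / γ₀ * Real.exp δ with hK₂
  set up := avgQkAdj C A (j + 1) (cb P N (j + 1) p) with hup
  set uq := avgQkAdj C A (j + 1) (cb P N (j + 1) q) with huq
  set Dop := propagatorK C Ω A msq a (j + 1) - propagatorK C Ω₀ A msq a (j + 1) with hDop
  have hk1 : 1 ≤ j + 1 := Nat.le_add_left 1 j
  have hL' : (1 : ℝ) < (P.L : ℝ) := by exact_mod_cast hL
  have hγ : 0 < γ₀ := gammaReg_pos (P := P) ha hL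
  have hM : 0 < P.mesh (j + 1) := P.mesh_pos _
  have hMd : 0 < P.mesh (j + 1) ^ P.d := pow_pos hM _
  have hK₁0 : 0 ≤ K₁ := by positivity
  have hK₂0 : 0 ≤ K₂ := by positivity
  have hΩsub : Ω ⊆ Ω₀ := subset_of_iff hΩΛ hΩ₀Λ₀ hsub
  have hreg : ∀ z ∈ Ω, ∀ μ ν : Fin P.d, |A ⟨z.shift ν, μ⟩ - A ⟨z, μ⟩| ≤ δA := fun z hz => hreg₀ z (hΩsub hz)
  have hakpos : 0 < B1.aSeq a P.L (j + 1) := B1.aSeq_pos ha hL' hk1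
  have haka : B1.aSeq a P.L (j + 1) ≤ a := B1.aSeq_le ha hL' (j + 1) hk1
  -- the three bounds on `X = ⟨u_p, D u_q⟩`
  have hDp := diag_decay_reg C ha hL hmsq hk1 hk hΩΛ hΩ₀Λ₀ hsub A hreg hsmall hδ0 hδ p hp
    (fun y' h1 h2 => hw p.1 y' h1 h2)
  have hDq := diag_decay_reg C ha hL hmsq hk1 hk hΩΛ hΩ₀Λ₀ hsub A hreg hsmall hδ0 hδ q hq
    (fun y' h1 h2 => hw q.1 y' h1 h2)
  have hCS := abs_siteInner_propagatorK_sub_le C a A hΩsub hmsq hakpos.le up uq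
  have hP := offdiag_pairing_reg C ha hL hmsq hk1 hk hΩΛ hΩ₀Λ₀ hsub A hreg₀ hsmall hδ0 hδ p q hq
  rw [← hγ₀, ← hup, ← hDop] at hDp
  rw [← hγ₀, ← huq, ← hDop] at hDq
  rw [← hDop] at hCS
  rw [← hγ₀, ← hup, ← huq, ← hDop] at hP
  rw [← hK₁] at hDp hDq
  -- `A = K₁ ℓ² e^{−δ(w_p + w_q)} ℓ^d` from Cauchy–Schwarz
  have hA : |siteInner up (Dop uq)| ≤ K₁ * P.mesh (j + 1) ^ 2 * Real.exp (-(δ * (w p.1 + w q.1))) * P.mesh (j + 1) ^ P.d := by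
    refine hCS.trans ?_
    rw [← Real.sqrt_mul (siteInner_propagatorK_sub_self_nonneg C a _ hΩsub hmsq hakpos.le up)]
    have hprod := mul_le_mul hDp hDq (siteInner_propagatorK_sub_self_nonneg C a _ hΩsub hmsq hakpos.le uq)
      (by positivity)
    refine (Real.sqrt_le_sqrt hprod).trans (le_of_eq ?_)
    have hee : Real.exp (-(2 * δ * w p.1)) * Real.exp (-(2 * δ * w q.1))
        = Real.exp (-(δ * (w p.1 + w q.1))) * Real.exp (-(δ * (w p.1 + w q.1))) := by
      rw [← Real.exp_add, ← Real.exp_add]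
      congr 1
      ring
    have hsq : K₁ * P.mesh (j + 1) ^ 2 * Real.exp (-(2 * δ * w p.1)) * P.mesh (j + 1) ^ P.d
        * (K₁ * P.mesh (j + 1) ^ 2 * Real.exp (-(2 * δ * w q.1)) * P.mesh (j + 1) ^ P.d)
        = (K₁ * P.mesh (j + 1) ^ 2 * Real.exp (-(δ * (w p.1 + w q.1))) * P.mesh (j + 1) ^ P.d) ^ 2 :=
      calc K₁ * P.mesh (j + 1) ^ 2 * Real.exp (-(2 * δ * w p.1)) * P.mesh (j + 1) ^ P.d
            * (K₁ * P.mesh (j + 1) ^ 2 * Real.exp (-(2 * δ * w q.1)) * P.mesh (j + 1) ^ P.d)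
          = (K₁ * P.mesh (j + 1) ^ 2 * P.mesh (j + 1) ^ P.d) * (K₁ * P.mesh (j + 1) ^ 2 * P.mesh (j + 1) ^ P.d)
            * (Real.exp (-(2 * δ * w p.1)) * Real.exp (-(2 * δ * w q.1))) := by ring
        _ = (K₁ * P.mesh (j + 1) ^ 2 * P.mesh (j + 1) ^ P.d) * (K₁ * P.mesh (j + 1) ^ 2 * P.mesh (j + 1) ^ P.d)
            * (Real.exp (-(δ * (w p.1 + w q.1))) * Real.exp (-(δ * (w p.1 + w q.1)))) := by rw [hee]
        _ = _ := by ring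
    rw [hsq, Real.sqrt_sq (by positivity)]
  -- `B = K₂ ℓ² e^{−δ t} ℓ^d` from the pairing
  have hB : |siteInner up (Dop uq)| ≤ K₂ * P.mesh (j + 1) ^ 2 *
      Real.exp (-(δ * (HiggsLattice.Site.tdist p.1 q.1 : ℝ))) * P.mesh (j + 1) ^ P.d := by
    rw [hK₂]
    exact hP
  -- interpolation
  have hX : |siteInner up (Dop uq)| ≤ (K₁ + K₂) / 2 * P.mesh (j + 1) ^ 2 *
      Real.exp (-(δ / 2 * ((HiggsLattice.Site.tdist p.1 q.1 : ℝ) + w p.1 + w q.1))) * P.mesh (j + 1) ^ P.d := by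
    refine (abs_le_sqrt_mul_of_le hA hB).trans ?_
    have hKK : K₁ * K₂ ≤ ((K₁ + K₂) / 2) ^ 2 := by nlinarith [sq_nonneg (K₁ - K₂)]
    set E := Real.exp (-(δ / 2 * ((HiggsLattice.Site.tdist p.1 q.1 : ℝ) + w p.1 + w q.1))) with hE
    have hee : Real.exp (-(δ * (w p.1 + w q.1))) * Real.exp (-(δ * (HiggsLattice.Site.tdist p.1 q.1 : ℝ))) = E * E := by
      rw [hE, ← Real.exp_add, ← Real.exp_add]
      congr 1
      ring
    have e : K₁ * P.mesh (j + 1) ^ 2 * Real.exp (-(δ * (w p.1 + w q.1))) * P.mesh (j + 1) ^ P.d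
        * (K₂ * P.mesh (j + 1) ^ 2 * Real.exp (-(δ * (HiggsLattice.Site.tdist p.1 q.1 : ℝ))) * P.mesh (j + 1) ^ P.d)
        = (K₁ * K₂) * (P.mesh (j + 1) ^ 2 * E * P.mesh (j + 1) ^ P.d) ^ 2 :=
      calc K₁ * P.mesh (j + 1) ^ 2 * Real.exp (-(δ * (w p.1 + w q.1))) * P.mesh (j + 1) ^ P.d
            * (K₂ * P.mesh (j + 1) ^ 2 * Real.exp (-(δ * (HiggsLattice.Site.tdist p.1 q.1 : ℝ))) * P.mesh (j + 1) ^ P.d)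
          = (K₁ * K₂) * (P.mesh (j + 1) ^ 2 * P.mesh (j + 1) ^ P.d) ^ 2
            * (Real.exp (-(δ * (w p.1 + w q.1))) * Real.exp (-(δ * (HiggsLattice.Site.tdist p.1 q.1 : ℝ)))) := by ring
        _ = (K₁ * K₂) * (P.mesh (j + 1) ^ 2 * P.mesh (j + 1) ^ P.d) ^ 2 * (E * E) := by rw [hee]
        _ = _ := by ring
    have hprod : K₁ * P.mesh (j + 1) ^ 2 * Real.exp (-(δ * (w p.1 + w q.1))) * P.mesh (j + 1) ^ P.d
        * (K₂ * P.mesh (j + 1) ^ 2 * Real.exp (-(δ * (HiggsLattice.Site.tdist p.1 q.1 : ℝ))) * P.mesh (j + 1) ^ P.d)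
        ≤ ((K₁ + K₂) / 2 * P.mesh (j + 1) ^ 2 * E * P.mesh (j + 1) ^ P.d) ^ 2 := by
      rw [e, show ((K₁ + K₂) / 2 * P.mesh (j + 1) ^ 2 * E * P.mesh (j + 1) ^ P.d) ^ 2
        = ((K₁ + K₂) / 2) ^ 2 * (P.mesh (j + 1) ^ 2 * E * P.mesh (j + 1) ^ P.d) ^ 2 by ring]
      exact mul_le_mul_of_nonneg_right hKK (sq_nonneg _)
    exact (Real.sqrt_le_sqrt hprod).trans (le_of_eq (Real.sqrt_sq (by positivity)))
  -- assemble with (2.21)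
  rw [mat_deltaKA_sub_eq C Ω Ω₀ A msq a j p q, ← hup, ← huq, ← hDop, abs_mul, abs_neg,
    abs_of_nonneg (by positivity : 0 ≤ coeff221 P a (j + 1) ^ 2 * (P.mesh (j + 1) ^ P.d)⁻¹)]
  have hc2 : coeff221 P a (j + 1) ^ 2 * (P.mesh (j + 1) ^ P.d)⁻¹
      * ((K₁ + K₂) / 2 * P.mesh (j + 1) ^ 2 *
        Real.exp (-(δ / 2 * ((HiggsLattice.Site.tdist p.1 q.1 : ℝ) + w p.1 + w q.1))) * P.mesh (j + 1) ^ P.d)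
      = B1.aSeq a P.L (j + 1) ^ 2 * ((K₁ + K₂) / 2) * ((P.mesh (j + 1))⁻¹ ^ 2) *
        Real.exp (-(δ / 2 * ((HiggsLattice.Site.tdist p.1 q.1 : ℝ) + w p.1 + w q.1))) := by
    rw [HiggsFluctMeasure.coeff221_eq]
    field_simp
  have ha2 : B1.aSeq a P.L (j + 1) ^ 2 ≤ a ^ 2 := pow_le_pow_left₀ hakpos.le haka 2
  calc coeff221 P a (j + 1) ^ 2 * (P.mesh (j + 1) ^ P.d)⁻¹ * |siteInner up (Dop uq)|
      ≤ coeff221 P a (j + 1) ^ 2 * (P.mesh (j + 1) ^ P.d)⁻¹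
        * ((K₁ + K₂) / 2 * P.mesh (j + 1) ^ 2 *
          Real.exp (-(δ / 2 * ((HiggsLattice.Site.tdist p.1 q.1 : ℝ) + w p.1 + w q.1))) * P.mesh (j + 1) ^ P.d) :=
        mul_le_mul_of_nonneg_left hX (by positivity)
    _ = B1.aSeq a P.L (j + 1) ^ 2 * ((K₁ + K₂) / 2) * ((P.mesh (j + 1))⁻¹ ^ 2) *
        Real.exp (-(δ / 2 * ((HiggsLattice.Site.tdist p.1 q.1 : ℝ) + w p.1 + w q.1))) := hc2
    _ ≤ a ^ 2 * ((K₁ + K₂) / 2) * ((P.mesh (j + 1))⁻¹ ^ 2) *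
        Real.exp (-(δ / 2 * ((HiggsLattice.Site.tdist p.1 q.1 : ℝ) + w p.1 + w q.1))) := by gcongr

end Assembly

/-! ## §5 The printed shapes: `dist(y, Ω^{(k)c})` as the weight, and the quantifier form of Proposition 2.2 at a regular `A` -/

section Printed

variable (C : ChargeData N) {msq a : ℝ}

open B1Ineq234Concrete (distC distC_le)

/-- **(2.29) at a regular `A` for nested regions with the PRINTED boundary weight `dist(y, Ω^{(k)c})`** (`= distC Λ_k`; dominated by the
distance to the defect set `Λ⁰_k ∖ Λ_k ⊆ Λ_kᶜ`), same constant as `ineq229_regular_region`. [cite: Balaban1982Higgs1, Prop. 2.2 (2.29) p.611] -/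
theorem ineq229_regular_region_distC (ha : 0 < a) (hL : 1 < P.L) (hmsq : 0 < msq) (j : ℕ) (hk : j + 1 ≤ P.K)
    (Ω Ω₀ : Finset (HiggsLattice.Site P 0)) (Λk Λ0k : Finset (HiggsLattice.Site P (j + 1)))
    (hΩΛ : ∀ x, x ∈ Ω ↔ blockIter (j + 1) x ∈ Λk) (hΩ₀Λ₀ : ∀ x, x ∈ Ω₀ ↔ blockIter (j + 1) x ∈ Λ0k) (hsub : Λk ⊆ Λ0k)
    (A : HiggsLattice.VecField P 0) {δA : ℝ}
    (hreg₀ : ∀ z ∈ Ω₀, ∀ μ ν : Fin P.d, |A ⟨z.shift ν, μ⟩ - A ⟨z, μ⟩| ≤ δA)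
    (hsmall : (P.d : ℝ) ^ 2 * (P.mesh 0 * |C.e|) * ((P.L : ℝ) ^ (j + 1)) ^ 2 * δA ≤ 1 / 3)
    {δ : ℝ} (hδ0 : 0 ≤ δ) (hδ : (4 * P.d + 4 * a) * δ ≤ min 2 (a * (1 - ((P.L : ℝ) ^ 2)⁻¹) / 4))
    (p q : HiggsLattice.Site P (j + 1) × Ix N) (hp : p.1 ∈ Λk) (hq : q.1 ∈ Λk) :
    |mat (deltaKA C Ω A msq a (j + 1)) p q - mat (deltaKA C Ω₀ A msq a (j + 1)) p q| ≤
      a ^ 2 * ((Real.exp (6 * δ) * ((P.d + a / 2) * (2 / min 2 (a * (1 - ((P.L : ℝ) ^ 2)⁻¹) / 4)) ^ 2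
          + (min 2 (a * (1 - ((P.L : ℝ) ^ 2)⁻¹) / 4))⁻¹)
          + 4 / min 2 (a * (1 - ((P.L : ℝ) ^ 2)⁻¹) / 4) * Real.exp δ) / 2) *
        ((P.mesh (j + 1))⁻¹ ^ 2) *
        Real.exp (-(δ / 2 * ((HiggsLattice.Site.tdist p.1 q.1 : ℝ) + distC Λk p.1 + distC Λk q.1))) :=
  ineq229_regular_region C ha hL hmsq j hk Ω Ω₀ Λk Λ0k hΩΛ hΩ₀Λ₀ hsub A hreg₀ hsmall hδ0 hδ (distC Λk)
    (fun y _ _ hy' => distC_le Λk y hy') p q hp hq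

/-- **PROPOSITION 2.2, SECOND CLAUSE (2.28)–(2.29), AT A REGULAR `A ≠ 0`, IN THE PRINTED QUANTIFIER SHAPE on the concrete (Higgs)₂,₃
carrier** (p. 611: *"If a configuration A is regular in the same sense as in Proposition 2.1 then there exist constants δ₀ > 0 and c₀,
depending on the same quantities as in Proposition 2.1, such that … |δΔ^{(k)}(Ω, Ω₀, A; x, x′)| ≦ c₀ exp(−δ₀(|x − x′| + dist(x, Ω^{(k)c})
+ dist(x′, Ω^{(k)c}))). (2.29)"*): for every `d`, `L > 1`, `a > 0` there are `δ₀, c₀ > 0` (functions of `d, L, a` only) such that for EVERY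
torus of the model with these `d, L` (every volume, every `ε`, every `K`), every `N`, charge data `C`, every `m² > 0`, every level
`1 ≤ k ≤ K`, every nested pair of block unions `Ω = B^k(Λ_k) ⊆ Ω₀ = B^k(Λ⁰_k)`, EVERY vector field `A` with one-step differences `≤ δ_A` on
`Ω₀` and `d²·ε|e|·L^{2k}·δ_A ≤ 1/3` («A regular», «e(L^kε) sufficiently small»), and all `x_p, x_q ∈ Λ_k`:
`|(Δ^{(k),L^kε}(Ω,A) − Δ^{(k),L^kε}(Ω₀,A))(p,q)| ≤ c₀(L^kε)⁻²exp(−δ₀(|x_p − x_q| + dist(x_p, Λ_kᶜ) + dist(x_q, Λ_kᶜ)))`.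
[cite: Balaban1982Higgs1, Prop. 2.2 (2.28)–(2.29) p.611, Prop. 2.1 (2.23) p.610] [cite: Balaban1983RegularityDecay, (5.5) p.594] -/
theorem prop22_second_regular_region (d L : ℕ) (hL : 1 < L) {a : ℝ} (ha : 0 < a) :
    ∃ δ₀ c₀ : ℝ, 0 < δ₀ ∧ 0 < c₀ ∧
      ∀ (P : HiggsLattice.Params), P.d = d → P.L = L → ∀ (N : ℕ) (C : ChargeData N) (msq : ℝ), 0 < msq →
        ∀ (j : ℕ), j + 1 ≤ P.K →
          ∀ (Ω Ω₀ : Finset (HiggsLattice.Site P 0)) (Λk Λ0k : Finset (HiggsLattice.Site P (j + 1))),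
            (∀ x, x ∈ Ω ↔ blockIter (j + 1) x ∈ Λk) → (∀ x, x ∈ Ω₀ ↔ blockIter (j + 1) x ∈ Λ0k) → Λk ⊆ Λ0k →
              ∀ (A : HiggsLattice.VecField P 0) (δA : ℝ),
                (∀ z ∈ Ω₀, ∀ μ ν : Fin P.d, |A ⟨z.shift ν, μ⟩ - A ⟨z, μ⟩| ≤ δA) →
                (P.d : ℝ) ^ 2 * (P.mesh 0 * |C.e|) * ((P.L : ℝ) ^ (j + 1)) ^ 2 * δA ≤ 1 / 3 →
              ∀ (p q : HiggsLattice.Site P (j + 1) × Ix N), p.1 ∈ Λk → q.1 ∈ Λk →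
                |mat (deltaKA C Ω A msq a (j + 1)) p q - mat (deltaKA C Ω₀ A msq a (j + 1)) p q| ≤
                  c₀ * ((P.mesh (j + 1))⁻¹ ^ 2) *
                    Real.exp (-(δ₀ * ((HiggsLattice.Site.tdist p.1 q.1 : ℝ) + distC Λk p.1 + distC Λk q.1))) := by
  have hL' : (1 : ℝ) < (L : ℝ) := by exact_mod_cast hL
  have hinv : ((L : ℝ) ^ 2)⁻¹ < 1 := inv_lt_one_of_one_lt₀ (by nlinarith)
  set γ₀ := min 2 (a * (1 - ((L : ℝ) ^ 2)⁻¹) / 4) with hγ₀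
  have hγ : 0 < γ₀ := lt_min (by norm_num) (by nlinarith [mul_pos ha (show (0:ℝ) < 1 - ((L : ℝ) ^ 2)⁻¹ by linarith)])
  have hden : (0 : ℝ) < 4 * d + 4 * a := by positivity
  set δ := γ₀ / (4 * d + 4 * a) with hδdef
  have hδ0 : 0 < δ := div_pos hγ hden
  set c₀ := a ^ 2 * ((Real.exp (6 * δ) * ((d + a / 2) * (2 / γ₀) ^ 2 + γ₀⁻¹) + 4 / γ₀ * Real.exp δ) / 2) with hc₀
  have hc : 0 < c₀ := by positivity
  refine ⟨δ / 2, c₀, by positivity, hc, ?_⟩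
  intro P hPd hPL N C msq hmsq j hk Ω Ω₀ Λk Λ0k hΩΛ hΩ₀Λ₀ hsub A δA hreg₀ hsmall p q hp hq
  subst hPd hPL
  have hPL1 : 1 < P.L := hL
  have hδ' : (4 * P.d + 4 * a) * δ ≤ min 2 (a * (1 - ((P.L : ℝ) ^ 2)⁻¹) / 4) := by
    rw [← hγ₀, hδdef, mul_div_cancel₀ _ hden.ne']
  have h := ineq229_regular_region_distC C ha hPL1 hmsq j hk Ω Ω₀ Λk Λ0k hΩΛ hΩ₀Λ₀ hsub A hreg₀ hsmall hδ0.le hδ' p q hp hq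
  rw [← hγ₀] at h
  exact h

end Printed

end Literature.MathematicalPhysics.QuantumFieldTheory.Balaban1983to89.B1Ineq229RegularRegion

end
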